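import Literature.Analysis.FluidPDE.NSSuitableESSProofs
import HarnessLib

/-!
# The Lions gate: the local energy EQUALITY of `L⁴ ∩ L₂W¹₂` distributional Navier–Stokes / Euler solutions

Analysis/FluidPDE proof file (theorems only).  J.-L. Lions (Rend. Sem. Mat. Univ. Padova 30 (1960), Thm. 1) and Shinbrot (SIAM J.
Math. Anal. 5 (1974)) proved that weak Navier–Stokes solutions in `L⁴(0,T;L⁴)` satisfy the energy EQUALITY; the tree holds the
global forms (`NSLionsEnergyEquality`, torus `DuchonRobertLionsEnergyEquality*`, `NSEnergyClassEnergyEquality`).  This file proves the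
LOCAL form on the unit parabolic cylinder `Q = (-1,0) × B(0,1) ⊂ ℝ × E`, for ANY viscosity `ν ∈ ℝ` — in particular `ν = 0`, EULER —
and in ANY dimension: a distributional solution `(v, p)` of `∂ₜv + div(v ⊗ v) − νΔv + ∇p = 0`, `div v = 0` in `Q` with
`v ∈ L_{2,∞}(Q) ∩ L⁴(Q)`, a square-integrable weak spatial gradient `∇v = G` on `Q` and `p ∈ L^{3/2}(Q)` satisfies, for a.e.
`t ∈ (-1,0)` and every test function `φ` on `(-1, ∞) × B(0,1)`, the sliced local energy identity of Caffarelli–Kohn–Nirenberg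
(CKN (2.5) / ESS (2.4)) WITH EQUALITY (`ae_localEnergyEquality_of_L4`).

The proof is the tree's `Literature.Analysis.FluidPDE.ae_localEnergyInequality_of_L3infty` (`FluidPDE/NSSuitableESSProofs`:
Escauriaza–Seregin–Šverák 2003, proof of Thm. 1.4, "usual mollification and the fact `v ∈ L₄(Q)`") run VERBATIM with three
changes: (i) the interior `L⁴` bound is a HYPOTHESIS (ESS derive it from `L_{3,∞} ∩ L₂W¹₂` by Gagliardo–Nirenberg in dimension 3,
`lintegral_pow_four_interior_lt_top`; here the dimension is free); (ii) the viscosity is a parameter `ν` (it enters only as the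
coefficient of `Δ`: the commutator of mollification and the quadratic nonlinearity is killed by `v ∈ L⁴` against the `L²` bound of
the mollified GRADIENT, which is the hypothesis `∇v ∈ L²` — dissipation for Navier–Stokes, the `E`-gauge for Seregin's power-gauged
ancient Euler class); (iii) all limits being strong, the conclusion is the EQUALITY (the ESS file weakens it to `≤` at the end).
Serves line `lions-gate` (stub O1 `stub_lionsGate`) of crux `EulerZoomLiouville.PowerGaugeEulerLiouville`
(stmt-NavierStokesRegularity-19832): integrability GATES anomalous dissipation inside the class.

NOT here: the passage from a member of the gauged class on the slab `(−∞,0) × ℝ³` to the unit cylinder (translation / parabolic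
scaling / covering) — that is the Summits-side assembly; forces; boundaries.

## References

* J.-L. Lions, *Sur la régularité et l'unicité des solutions turbulentes des équations de Navier Stokes*, Rend. Sem. Mat. Univ.
  Padova 30 (1960), 16–23, Thm. 1.
* M. Shinbrot, *The energy equation for the Navier–Stokes system*, SIAM J. Math. Anal. 5 (1974), 948–954.
* L. Escauriaza, G. Seregin, V. Šverák, *`L_{3,∞}`-solutions of Navier–Stokes equations and backward uniqueness*, Russ. Math.
  Surveys 58:2 (2003), proof of Thm. 1.4, first paragraph. [EscauriazaSereginSverak2003]
* L. Caffarelli, R. Kohn, L. Nirenberg, CPAM 35 (1982), §2, (2.5) and the remark following it. [CaffarelliKohnNirenberg1982]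
-/

noncomputable section

open MeasureTheory TopologicalSpace Set Function Filter Topology ContinuousLinearMap Metric
  InnerProductSpace Module
open scoped ENNReal NNReal Convolution RealInnerProductSpace Laplacian

namespace Literature.Analysis.FluidPDE

section Main

variable {E : Type*} [NormedAddCommGroup E] [InnerProductSpace ℝ E] [FiniteDimensional ℝ E]
  [MeasurableSpace E] [BorelSpace E]

-- adapted from `ae_localEnergyInequality_of_L3infty` (FluidPDE/NSSuitableESSProofs): ν general, L⁴ a hypothesis, equality
set_option maxHeartbeats 800000 in
/-- **THE LOCAL ENERGY EQUALITY OF `L⁴ ∩ L₂W¹₂` DISTRIBUTIONAL NAVIER–STOKES / EULER SOLUTIONS — THE LIONS GATE ON THE UNIT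
CYLINDER** (J.-L. Lions 1960 / Shinbrot 1974: `u ∈ L⁴ₜ,ₓ` weak solutions satisfy the energy EQUALITY; Escauriaza–Seregin–Šverák 2003,
proof of Thm. 1.4, first paragraph: "this can be verified with the help of usual mollification and the fact `v ∈ L₄(Q)`").
Let `Q = (-1, 0) × B(0, 1)` in `ℝ × E` (`E` any finite-dimensional real inner product space of positive dimension), `ν ∈ ℝ` ANY
viscosity (`ν = 0`: Euler), `(v, p)` a distributional solution (no force) in `Q` with `v ∈ L_{2,∞}(Q)`, a square-integrable weak
spatial gradient `G` on `Q`, `p ∈ L_{3/2}(Q)`, and **`v ∈ L⁴(Q)`**.  Then for a.e. `t ∈ (-1, 0)` and EVERY test function `φ` on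
`(-1, ∞) × B(0, 1)` the sliced local energy identity holds WITH EQUALITY:
`∫_B φ|v|²(t) + 2ν ∫_{-1}^t ∫_B φ |∇v|² = ∫_{-1}^t ∫_B (|v|² (νΔφ + ∂ₜφ) + v·∇φ (|v|² + 2p))`.
Proof = the tree's `ae_localEnergyInequality_of_L3infty` (ESS's "usual mollification") VERBATIM, with the interior `L⁴` bound now a
hypothesis instead of the `L_{3,∞} ∩ L₂W¹₂ ⊂ L⁴` interpolation `lintegral_pow_four_interior_lt_top` (so the dimension is free and the
viscosity may vanish): mollify in space–time, write the smooth local energy identity (`local_energy_identity_smooth`), pass to the limit —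
every limit is a STRONG `Lᵖ` limit (`v_n → v` in `L²∩L³`, locally in `L⁴`; `(vᵢv)_n → vᵢv` in `L²`; `∇v_n → ∇v` in `L²`;
`p_n → p` in `L^{3/2}`; sliced `L²` convergence at a.e. time along a subsequence), so the identity survives as an equality.  The
viscosity is used nowhere except as a coefficient: the commutator `(vᵢv)_n − (v_n)ᵢ v_n → 0` in `L²` is paired with `∇v_n`, bounded in
`L²` by the HYPOTHESIS `∇v ∈ L²` — in the Navier–Stokes case that is the dissipation, in Seregin's gauged Euler class it is the
`E`-gauge (line `lions-gate` of crux `EulerZoomLiouville.PowerGaugeEulerLiouville`).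
[cite: EscauriazaSereginSverak2003, §3, proof of Thm. 1.4, first paragraph] -/
theorem ae_localEnergyEquality_of_L4 [Nontrivial E] {ν : ℝ} {ω : Opens E}
    (hω : (ω : Set E) = ball (0 : E) 1) {v : ℝ → E → E} {p : ℝ → E → ℝ}
    {G : ℝ → E → E →L[ℝ] E}
    (hNS : IsDistributionalNSSolutionOn (parabolicCylinderOpens 1 ((0 : ℝ), (0 : E))) ν 0 v p)
    (h2 : ∃ C : ℝ≥0, ∀ᵐ t ∂(volume.restrict (Ioo (-1 : ℝ) 0)),
      ∫⁻ x in ball (0 : E) 1, ‖v t x‖ₑ ^ 2 ≤ C)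
    (hG : HasWeakSpatialGradientOn (parabolicCylinderOpens 1 ((0 : ℝ), (0 : E))) v G)
    (hG2 : ∫⁻ z in parabolicCylinder 1 ((0 : ℝ), (0 : E)),
      ENNReal.ofReal (frobeniusNormSq (G z.1 z.2)) < ∞)
    (hp : ∫⁻ z in parabolicCylinder 1 ((0 : ℝ), (0 : E)), ‖p z.1 z.2‖ₑ ^ (3 / 2 : ℝ) < ∞)
    (h4Q : ∫⁻ z in parabolicCylinder 1 ((0 : ℝ), (0 : E)), ‖v z.1 z.2‖ₑ ^ (4 : ℝ) < ∞) :
    ∀ᵐ t ∂(volume.restrict (Ioo (-1 : ℝ) 0)), ∀ φ : ℝ → E → ℝ,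
      IsSpaceTimeTestOn (forwardCylinder ω (-1)) φ →
      (∫ x in (ω : Set E), φ t x * ‖v t x‖ ^ 2) +
          2 * ν * (∫ z in Ioo (-1 : ℝ) t ×ˢ (ω : Set E),
            φ z.1 z.2 * frobeniusNormSq (G z.1 z.2)) =
        ∫ z in Ioo (-1 : ℝ) t ×ˢ (ω : Set E),
          (‖v z.1 z.2‖ ^ 2 * (ν * (Δ (φ z.1)) z.2 + timeDeriv φ z.1 z.2) +
            ⟪v z.1 z.2, gradient (φ z.1) z.2⟫ * (‖v z.1 z.2‖ ^ 2 + 2 * p z.1 z.2)) := by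
  -- small constants in `ℝ≥0∞`
  have one_le_three_halves : (1 : ℝ≥0∞) ≤ 3 / 2 := by
    have h : (1 : ℝ≥0∞) = 2 / 2 := (ENNReal.div_self two_ne_zero ENNReal.ofNat_ne_top).symm
    rw [h]
    gcongr
    norm_num
  have three_halves_ne_top : (3 / 2 : ℝ≥0∞) ≠ ∞ := ENNReal.div_ne_top (by norm_num) (by norm_num)
  have three_halves_ne_zero : (3 / 2 : ℝ≥0∞) ≠ 0 :=
    (ENNReal.div_pos (by norm_num) (by norm_num)).ne'
  haveI : (volume : Measure (ℝ × E)).IsAddHaarMeasure := Measure.prod.instIsAddHaarMeasure _ _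
  set b := stdOrthonormalBasis ℝ E with hb
  -- ## (0) the cylinder and the space–time classes of `v`, `p`, `G`
  set Qo : Opens (ℝ × E) := parabolicCylinderOpens 1 ((0 : ℝ), (0 : E)) with hQo
  have hQ : (Qo : Set (ℝ × E)) = Ioo (-1 : ℝ) 0 ×ˢ ball (0 : E) 1 := by
    rw [hQo, coe_parabolicCylinderOpens, parabolicCylinder_one_zero]
  have hQ' : parabolicCylinder 1 ((0 : ℝ), (0 : E)) = Ioo (-1 : ℝ) 0 ×ˢ ball (0 : E) 1 :=
    parabolicCylinder_one_zero
  rw [hQ'] at hG2 hp h4Q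
  have hQm : MeasurableSet (Ioo (-1 : ℝ) 0 ×ˢ ball (0 : E) 1) :=
    measurableSet_Ioo.prod measurableSet_ball
  have hIfin : volume (Ioo (-1 : ℝ) 0) < ∞ := measure_Ioo_lt_top
  haveI : IsFiniteMeasure (volume.restrict (Ioo (-1 : ℝ) 0 ×ˢ ball (0 : E) 1)) := by
    refine ⟨?_⟩
    rw [Measure.restrict_apply_univ, Measure.volume_eq_prod, Measure.prod_prod]
    exact ENNReal.mul_lt_top measure_Ioo_lt_top measure_ball_lt_top
  obtain ⟨C₂, h2⟩ := h2
  -- measurability on `Q`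
  have hvm : AEStronglyMeasurable (uncurry v) (volume.restrict (Ioo (-1 : ℝ) 0 ×ˢ ball (0 : E) 1)) := by
    have := hNS.1.aestronglyMeasurable; rwa [hQ] at this
  have hpm : AEStronglyMeasurable (uncurry p) (volume.restrict (Ioo (-1 : ℝ) 0 ×ˢ ball (0 : E) 1)) := by
    have := hNS.2.2.1.aestronglyMeasurable; rwa [hQ] at this
  have hGm : AEStronglyMeasurable (uncurry G) (volume.restrict (Ioo (-1 : ℝ) 0 ×ˢ ball (0 : E) 1)) := by
    have := hG.locallyIntegrableOn_grad.aestronglyMeasurable; rwa [hQ] at this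
  -- the classes
  have hv2Q : MemLp (uncurry v) 2 (volume.restrict (Ioo (-1 : ℝ) 0 ×ˢ ball (0 : E) 1)) :=
    memLp_of_slice_bound hIfin hvm two_ne_zero ENNReal.coe_lt_top (n := 2) (by exact_mod_cast h2)
  have hv4Q : MemLp (uncurry v) 4 (volume.restrict (Ioo (-1 : ℝ) 0 ×ˢ ball (0 : E) 1)) := by
    refine memLp_of_lintegral_rpow_lt_top (by norm_num) (by norm_num) hvm ?_
    have : ((4 : ℝ≥0∞)).toReal = 4 := by norm_num
    rw [this]
    exact h4Q
  have hv3Q : MemLp (uncurry v) 3 (volume.restrict (Ioo (-1 : ℝ) 0 ×ˢ ball (0 : E) 1)) :=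
    hv4Q.mono_exponent (by norm_num)
  have hpQ : MemLp (uncurry p) (3 / 2) (volume.restrict (Ioo (-1 : ℝ) 0 ×ˢ ball (0 : E) 1)) := by
    refine memLp_of_lintegral_rpow_lt_top three_halves_ne_zero three_halves_ne_top hpm ?_
    have : ((3 : ℝ≥0∞) / 2).toReal = 3 / 2 := by
      rw [ENNReal.toReal_div]; norm_num
    rw [this]
    exact hp
  have hGQ : MemLp (uncurry G) 2 (volume.restrict (Ioo (-1 : ℝ) 0 ×ˢ ball (0 : E) 1)) :=
    memLp_two_of_frobeniusNormSq hGm hG2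
  -- integrability on `Q`
  have hvI : IntegrableOn (uncurry v) (Ioo (-1 : ℝ) 0 ×ˢ ball (0 : E) 1) volume :=
    hv2Q.integrable one_le_two
  have hv2I : IntegrableOn (fun z => ‖uncurry v z‖ ^ 2) (Ioo (-1 : ℝ) 0 ×ˢ ball (0 : E) 1)
      volume := by
    exact hv2Q.integrable_norm_pow two_ne_zero
  have hpI : IntegrableOn (uncurry p) (Ioo (-1 : ℝ) 0 ×ˢ ball (0 : E) 1) volume :=
    hpQ.integrable one_le_three_halves
  have hGI : IntegrableOn (uncurry G) (Ioo (-1 : ℝ) 0 ×ˢ ball (0 : E) 1) volume :=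
    hGQ.integrable one_le_two
  have hvI' : IntegrableOn (uncurry v) (Qo : Set (ℝ × E)) volume := by rwa [hQ]
  have hv2I' : IntegrableOn (fun z => ‖uncurry v z‖ ^ 2) (Qo : Set (ℝ × E)) volume := by rwa [hQ]
  have hpI' : IntegrableOn (uncurry p) (Qo : Set (ℝ × E)) volume := by rwa [hQ]
  have hGI' : IntegrableOn (uncurry G) (Qo : Set (ℝ × E)) volume := by rwa [hQ]
  -- ## (1) the zero extensions and their whole-space classes
  set ũ : ℝ × E → E := zeroExt Qo v with hũ
  set pt : ℝ × E → ℝ := zeroExt Qo p with hpt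
  set Gt : ℝ × E → E →L[ℝ] E := zeroExt Qo G with hGt
  have hũ2 : MemLp ũ 2 volume := memLp_zeroExt hQ hQm hv2Q
  have hũ3 : MemLp ũ 3 volume := memLp_zeroExt hQ hQm hv3Q
  have hpt32 : MemLp pt (3 / 2) volume := memLp_zeroExt hQ hQm hpQ
  have hGt2 : MemLp Gt 2 volume := memLp_zeroExt hQ hQm hGQ
  have hũi : LocallyIntegrable ũ volume := locallyIntegrable_zeroExt hvI'
  have hpti : LocallyIntegrable pt volume := locallyIntegrable_zeroExt hpI'
  have hGti : LocallyIntegrable Gt volume := locallyIntegrable_zeroExt hGI'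
  -- ## (2) the mollifiers
  obtain ⟨bump, hbr, -⟩ := FunctionSpaces.exists_contDiffBump_seq (E := ℝ × E)
  set k : ℕ → ℝ × E → ℝ := fun n => (bump n).normed volume with hk
  have hkinf : ∀ n, ContDiff ℝ (⊤ : ℕ∞) (k n) := fun n => (bump n).contDiff_normed
  have hkr : ∀ n w, w ∉ closedBall (0 : ℝ × E) (bump n).rOut → k n w = 0 := fun n w hw => by
    have : w ∉ Function.support (k n) := by
      rw [hk, (bump n).support_normed_eq]; exact fun h => hw (ball_subset_closedBall h)
    simpa using this
  have hkc : ∀ n, HasCompactSupport (k n) := fun n => (bump n).hasCompactSupport_normed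
  set V : ℕ → ℝ → E → E := fun n => stMollify (k n) ũ with hV
  set Pm : ℕ → ℝ → E → ℝ := fun n => stMollify (k n) pt with hPm
  set Gm : ℕ → ℝ → E → (E →L[ℝ] E) := fun n => stMollify (k n) Gt with hGm
  set Nt : Fin (finrank ℝ E) → ℝ × E → E := fun i => zeroExt Qo fun t x => ⟪v t x, b i⟫ • v t x
    with hNt
  have hNt' : ∀ i, Nt i = fun z => ⟪ũ z, b i⟫ • ũ z := fun i => by
    rw [hNt]; exact zeroExt_inner_smul v (b i)
  have hNti : ∀ i, IntegrableOn (uncurry fun t x => ⟪v t x, b i⟫ • v t x) (Qo : Set (ℝ × E))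
      volume := by
    intro i
    refine Integrable.mono' (hv2I'.mul_const ‖b i‖) ?_ (Eventually.of_forall fun z => ?_)
    · exact (hvI'.aestronglyMeasurable.inner aestronglyMeasurable_const).smul
        hvI'.aestronglyMeasurable
    · change ‖⟪v z.1 z.2, b i⟫ • v z.1 z.2‖ ≤ ‖uncurry v z‖ ^ 2 * ‖b i‖
      rw [norm_smul]
      calc ‖⟪v z.1 z.2, b i⟫‖ * ‖v z.1 z.2‖ ≤ (‖v z.1 z.2‖ * ‖b i‖) * ‖v z.1 z.2‖ := by
            gcongr; exact norm_inner_le_norm _ _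
        _ = ‖uncurry v z‖ ^ 2 * ‖b i‖ := by rw [show uncurry v z = v z.1 z.2 from rfl]; ring
  have hNtli : ∀ i, LocallyIntegrable (Nt i) volume := fun i => locallyIntegrable_zeroExt (hNti i)
  set N : ℕ → Fin (finrank ℝ E) → ℝ → E → E := fun n i => stMollify (k n) (Nt i) with hN
  -- smoothness and continuity of the mollified fields
  have hVsm : ∀ n, ContDiff ℝ (⊤ : ℕ∞) (uncurry (V n)) := fun n =>
    contDiff_uncurry_stMollify (hkinf n) (hkc n) hũi
  have hPsm : ∀ n, ContDiff ℝ (⊤ : ℕ∞) (uncurry (Pm n)) := fun n =>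
    contDiff_uncurry_stMollify (hkinf n) (hkc n) hpti
  have hNsm : ∀ n i, ContDiff ℝ (⊤ : ℕ∞) (uncurry (N n i)) := fun n i =>
    contDiff_uncurry_stMollify (hkinf n) (hkc n) (hNtli i)
  have hGsm : ∀ n, ContDiff ℝ (⊤ : ℕ∞) (uncurry (Gm n)) := fun n =>
    contDiff_uncurry_stMollify (hkinf n) (hkc n) hGti
  have hVc : ∀ n, Continuous (uncurry (V n)) := fun n => (hVsm n).continuous
  have hPc : ∀ n, Continuous (uncurry (Pm n)) := fun n => (hPsm n).continuous
  have hNc : ∀ n i, Continuous (uncurry (N n i)) := fun n i => (hNsm n i).continuous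
  have hGc : ∀ n, Continuous (uncurry (Gm n)) := fun n => (hGsm n).continuous
  -- whole-space convergence of the mollifications
  have cV2 : Tendsto (fun n => eLpNorm (uncurry (V n) - ũ) 2 volume) atTop (𝓝 0) :=
    FunctionSpaces.tendsto_eLpNorm_normed_convolution_sub_self hbr (by norm_num) (by norm_num) hũ2
  have cV3 : Tendsto (fun n => eLpNorm (uncurry (V n) - ũ) 3 volume) atTop (𝓝 0) :=
    FunctionSpaces.tendsto_eLpNorm_normed_convolution_sub_self hbr (by norm_num) (by norm_num) hũ3
  have cP : Tendsto (fun n => eLpNorm (uncurry (Pm n) - pt) (3 / 2) volume) atTop (𝓝 0) :=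
    FunctionSpaces.tendsto_eLpNorm_normed_convolution_sub_self hbr one_le_three_halves three_halves_ne_top hpt32
  have cG : Tendsto (fun n => eLpNorm (uncurry (Gm n) - Gt) 2 volume) atTop (𝓝 0) :=
    FunctionSpaces.tendsto_eLpNorm_normed_convolution_sub_self hbr (by norm_num) (by norm_num) hGt2
  -- whole-space classes of the mollifications
  have mV2 : ∀ n, MemLp (uncurry (V n)) 2 volume := fun n =>
    UnboundedOperators.memLp_convolution_lsmul (bump n).integrable_normed hũ2 (by norm_num)
  have mV3 : ∀ n, MemLp (uncurry (V n)) 3 volume := fun n =>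
    UnboundedOperators.memLp_convolution_lsmul (bump n).integrable_normed hũ3 (by norm_num)
  have mP : ∀ n, MemLp (uncurry (Pm n)) (3 / 2) volume := fun n =>
    UnboundedOperators.memLp_convolution_lsmul (bump n).integrable_normed hpt32 one_le_three_halves
  have mG : ∀ n, MemLp (uncurry (Gm n)) 2 volume := fun n =>
    UnboundedOperators.memLp_convolution_lsmul (bump n).integrable_normed hGt2 (by norm_num)
  -- ## (3) a subsequence with sliced `L²` convergence for a.e. time, and the good times
  obtain ⟨ns, hns, hsl⟩ := exists_subseq_tendsto_eLpNorm_slice (ν := (volume : Measure E))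
    (D := fun n z => V n z.1 z.2 - ũ z)
    (fun n => by
      rw [← Measure.volume_eq_prod]; exact ((mV2 n).sub hũ2).1)
    (fun n => by
      rw [← Measure.volume_eq_prod]; exact ((mV2 n).sub hũ2).eLpNorm_lt_top)
    (by rw [← Measure.volume_eq_prod]; exact cV2)
  have hfinslice : ∀ᵐ s : ℝ, ∫⁻ y, ‖ũ (s, y)‖ₑ ^ 2 < ∞ := by
    have hm : AEMeasurable (fun z : ℝ × E => ‖ũ z‖ₑ ^ 2)
        ((volume : Measure ℝ).prod (volume : Measure E)) := by
      rw [← Measure.volume_eq_prod]; exact hũ2.1.enorm.pow_const 2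
    refine ae_lt_top' hm.lintegral_prod_right' ?_
    rw [← lintegral_prod _ hm, ← Measure.volume_eq_prod, ← MollifiedLimits.eLpNorm_two_pow_two]
    exact ENNReal.pow_ne_top hũ2.eLpNorm_lt_top.ne
  have hmslice : ∀ᵐ s : ℝ, AEStronglyMeasurable (fun y => ũ (s, y)) volume := by
    set ũ' : ℝ × E → E := hũ2.1.mk ũ with hũ'
    have hsm : StronglyMeasurable ũ' := hũ2.1.stronglyMeasurable_mk
    have e : ũ =ᵐ[volume] ũ' := hũ2.1.ae_eq_mk
    rw [Measure.volume_eq_prod] at e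
    have h1 : ∀ᵐ s : ℝ, ∀ᵐ y : E, ũ (s, y) = ũ' (s, y) := Measure.ae_ae_eq_curry_of_prod e
    filter_upwards [h1] with s hs
    exact ⟨fun y => ũ' (s, y), hsm.comp_measurable measurable_prodMk_left, hs⟩
  have hbrs : Tendsto (fun j => (bump (ns j)).rOut) atTop (𝓝 0) := hbr.comp hns.tendsto_atTop
  -- compact support of the mollified velocity (for the slice at time `t`)
  have hQbdd : Bornology.IsBounded (Qo : Set (ℝ × E)) := by
    rw [hQ]
    exact (Metric.isBounded_Ioo (-1 : ℝ) 0).prod Metric.isBounded_ball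
  have hVcs : ∀ n, HasCompactSupport (uncurry (V n)) := fun n =>
    (hkc n).convolution _ (hasCompactSupport_zeroExt hQbdd v)
  -- ## (4) the good times
  filter_upwards [ae_restrict_mem measurableSet_Ioo, ae_restrict_of_ae hsl,
    ae_restrict_of_ae hfinslice, ae_restrict_of_ae hmslice] with t ht hts htf htm
  intro φ hφ
  -- ### (a) support geometry of `φ` below time `t`
  have hω' : ∀ {s : ℝ} {y : E}, φ s y ≠ 0 → -1 < s ∧ y ∈ ball (0 : E) 1 := fun {s y} h => by
    have hz : (s, y) ∈ (forwardCylinder ω (-1) : Set (ℝ × E)) :=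
      hφ.tsupport_subset (subset_tsupport _ (by exact h))
    rw [coe_forwardCylinder, hω] at hz
    exact ⟨hz.1, hz.2⟩
  obtain ⟨Kx, hKx, hKxt⟩ := hφ.exists_compact_slice_subset
  have hφKx : ∀ s, ∀ y ∉ Kx, φ s y = 0 := fun s y hy =>
    image_eq_zero_of_notMem_tsupport fun h => hy (hKxt s h)
  set Kt : Set (ℝ × E) := tsupport (uncurry φ) ∩ (Iic t ×ˢ univ) with hKt_def
  have hKt : IsCompact Kt := hφ.hasCompactSupport.inter_right (isClosed_Iic.prod isClosed_univ)
  have hKtQ : Kt ⊆ Ioo (-1 : ℝ) 0 ×ˢ ball (0 : E) 1 := by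
    rintro ⟨s, y⟩ ⟨h1, h2⟩
    have hz : (s, y) ∈ (forwardCylinder ω (-1) : Set (ℝ × E)) := hφ.tsupport_subset h1
    rw [coe_forwardCylinder, hω] at hz
    exact ⟨⟨hz.1, lt_of_le_of_lt h2.1 ht.2⟩, hz.2⟩
  have hmemKt : ∀ {s : ℝ} {y : E}, s < t → φ s y ≠ 0 → (s, y) ∈ Kt := fun {s y} hs h =>
    ⟨subset_tsupport _ (by exact h), ⟨hs.le, mem_univ _⟩⟩
  have hmemKt' : ∀ {s : ℝ} {y : E}, s ≤ t → (s, y) ∈ tsupport (uncurry φ) → (s, y) ∈ Kt :=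
    fun {s y} hs h => ⟨h, ⟨hs, mem_univ _⟩⟩
  obtain ⟨ε, hε, hε1, hmargin⟩ := exists_margin_of_isCompact hKt hKtQ
  set Q' : Set (ℝ × E) := Ioo (-1 + ε / 2) (-(ε / 2)) ×ˢ ball (0 : E) (1 - ε / 2) with hQ'_def
  have hQ'm : MeasurableSet Q' := measurableSet_Ioo.prod measurableSet_ball
  have hQ'Q : Q' ⊆ Ioo (-1 : ℝ) 0 ×ˢ ball (0 : E) 1 := box_subset_unitCylinder hε
  have hQ'Qo : Q' ⊆ (Qo : Set (ℝ × E)) := by rw [hQ]; exact hQ'Q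
  have hballKt : ∀ z ∈ Kt, ∀ r, r ≤ ε / 2 → closedBall z r ⊆ Q' := fun z hz r hr =>
    closedBall_subset_box (hmargin z hz) hr
  have hKtQ' : Kt ⊆ Q' := fun z hz => hballKt z hz 0 (by linarith) (mem_closedBall_self le_rfl)
  -- the interior `L⁴` bound and the localised fields
  have h4 : ∫⁻ z in Q', ‖ũ z‖ₑ ^ 4 < ∞ := by
    have e1 : ∫⁻ z in Q', ‖ũ z‖ₑ ^ 4 = ∫⁻ z in Q', ‖v z.1 z.2‖ₑ ^ (4 : ℝ) := by
      refine setLIntegral_congr_fun hQ'm fun z hz => ?_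
      rw [hũ, zeroExt_of_mem _ (hQ'Qo hz), ← ENNReal.rpow_natCast]
      norm_num
    rw [e1]
    exact lt_of_le_of_lt (lintegral_mono_set hQ'Q) h4Q
  set uQ : ℝ × E → E := Q'.indicator ũ with huQ
  have huQ4 : MemLp uQ 4 volume := by
    rw [huQ, memLp_indicator_iff_restrict hQ'm]
    refine ⟨hũ2.1.restrict, ?_⟩
    have h1 : eLpNorm ũ 4 (volume.restrict Q') ^ 4 < ∞ := by
      have e := eLpNorm_natCast_pow_eq_lintegral' (μ := volume.restrict Q') ũ (n := 4) (by norm_num)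
      simp only [Nat.cast_ofNat] at e
      rw [e]; exact h4
    by_contra htop
    rw [not_lt, top_le_iff] at htop
    rw [htop, ENNReal.top_pow (by norm_num)] at h1
    exact lt_irrefl _ h1
  have huQ2 : MemLp uQ 2 volume := by rw [huQ]; exact hũ2.indicator hQ'm
  have huQ3 : MemLp uQ 3 volume := by rw [huQ]; exact hũ3.indicator hQ'm
  set NQ : Fin (finrank ℝ E) → ℝ × E → E := fun i z => ⟪uQ z, b i⟫ • uQ z with hNQ
  haveI hHT442 : ENNReal.HolderTriple 4 4 2 := by
    simpa using holderTriple_ofReal (a := 4) (b := 4) (c := 2) (by norm_num) (by norm_num)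
      (by norm_num) (by norm_num)
  haveI hHT24 : ENNReal.HolderTriple 2 4 (4 / 3) := holderTriple_two_four
  haveI hHT41 : ENNReal.HolderTriple (4 / 3) 4 1 := holderTriple_fourThirds_four
  haveI hHT33 : ENNReal.HolderTriple 3 3 (3 / 2) := by
    have h := holderTriple_ofReal (a := 3) (b := 3) (c := 3 / 2) (by norm_num) (by norm_num)
      (by norm_num) (by norm_num)
    rwa [ENNReal.ofReal_ofNat, ENNReal.ofReal_div_of_pos (by norm_num), ENNReal.ofReal_ofNat,
      ENNReal.ofReal_ofNat] at h
  haveI hHT31 : ENNReal.HolderTriple (3 / 2) 3 1 := by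
    have h := holderTriple_ofReal (a := 3 / 2) (b := 3) (c := 1) (by norm_num) (by norm_num)
      (by norm_num) (by norm_num)
    rwa [ENNReal.ofReal_ofNat, ENNReal.ofReal_div_of_pos (by norm_num), ENNReal.ofReal_ofNat,
      ENNReal.ofReal_ofNat, ENNReal.ofReal_one] at h
  haveI hHT22 : ENNReal.HolderTriple 2 2 1 := ENNReal.HolderConjugate.instTwoTwo
  have hNQ2 : ∀ i, MemLp (NQ i) 2 volume := fun i => by
    have := memLp_bilin (p := 4) (q := 4) (r := 2) (innerSmulBilin (b i)) huQ4 huQ4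
    simpa [hNQ] using this
  set VQ : ℕ → ℝ → E → E := fun n => stMollify (k n) uQ with hVQ
  set NQm : ℕ → Fin (finrank ℝ E) → ℝ → E → E := fun n i => stMollify (k n) (NQ i) with hNQm
  have cVQ4 : Tendsto (fun n => eLpNorm (uncurry (VQ n) - uQ) 4 volume) atTop (𝓝 0) :=
    FunctionSpaces.tendsto_eLpNorm_normed_convolution_sub_self hbr (by norm_num) (by norm_num) huQ4
  have cNQ : ∀ i, Tendsto (fun n => eLpNorm (uncurry (NQm n i) - NQ i) 2 volume) atTop (𝓝 0) :=
    fun i => FunctionSpaces.tendsto_eLpNorm_normed_convolution_sub_self hbr (by norm_num) (by norm_num) (hNQ2 i)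
  have mVQ4 : ∀ n, MemLp (uncurry (VQ n)) 4 volume := fun n =>
    UnboundedOperators.memLp_convolution_lsmul (bump n).integrable_normed huQ4 (by norm_num)
  have mNQ : ∀ n i, MemLp (uncurry (NQm n i)) 2 volume := fun n i =>
    UnboundedOperators.memLp_convolution_lsmul (bump n).integrable_normed (hNQ2 i) (by norm_num)
  -- locality: on `Kt` the mollified fields only see `Q'`
  have hloc : ∀ n, (bump n).rOut ≤ ε / 2 → ∀ z ∈ Kt,
      V n z.1 z.2 = VQ n z.1 z.2 ∧ ∀ i, N n i z.1 z.2 = NQm n i z.1 z.2 := by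
    intro n hn z hz
    have hsub := hballKt z hz _ hn
    have e1 : EqOn ũ uQ (closedBall z (bump n).rOut) := fun w hw => by
      rw [huQ, indicator_of_mem (hsub hw)]
    have e2 : ∀ i, EqOn (Nt i) (NQ i) (closedBall z (bump n).rOut) := fun i w hw => by
      rw [hNt' i]
      simp only [hNQ, huQ, indicator_of_mem (hsub hw)]
    refine ⟨?_, fun i => ?_⟩
    · exact convolution_lsmul_congr_of_eqOn (hkr n) e1
    · exact convolution_lsmul_congr_of_eqOn (hkr n) (e2 i)
  -- ### (b) the mollified equations on `{φ ≠ 0}` below time `t`, and the energy identity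
  have hEQ : ∀ n, (bump n).rOut ≤ ε / 2 → ∀ s ∈ Ioo (-1 : ℝ) t, ∀ y, φ s y ≠ 0 →
      (∀ i, ⟪timeDeriv (V n) s y, b i⟫ + VectorCalculus.divergence (N n i s) y - ν * ⟪(Δ (V n s)) y, b i⟫ +
        fderiv ℝ (Pm n s) y (b i) = 0) ∧
      VectorCalculus.divergence (V n s) y = 0 ∧ fderiv ℝ (V n s) y = Gm n s y := by
    intro n hn s hs y hy
    have hz : (s, y) ∈ Kt := hmemKt hs.2 hy
    have hsub : closedBall ((s, y) : ℝ × E) (bump n).rOut ⊆ (Qo : Set (ℝ × E)) :=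
      (hballKt _ hz _ hn).trans hQ'Qo
    exact ⟨fun i => hNS.mollified_momentum hvI' hv2I' hpI' (hkinf n) (hkr n) hsub (b i),
      hNS.divergence_mollified_eq_zero hvI' (hkinf n) (hkr n) hsub,
      hG.fderiv_mollified hvI' hGI' (hkinf n) (hkr n) hsub⟩
  have hφa : ∀ y, φ (-1) y = 0 := fun y => by
    by_contra h
    exact lt_irrefl _ (hω' h).1
  have hID : ∀ n, (bump n).rOut ≤ ε / 2 →
      (∫ y, φ t y * ‖V n t y‖ ^ 2) + 2 * ν * ∫ z in Ioo (-1 : ℝ) t ×ˢ (univ : Set E),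
          φ z.1 z.2 * frobeniusNormSq (fderiv ℝ (V n z.1) z.2) =
      ∫ z in Ioo (-1 : ℝ) t ×ˢ (univ : Set E), (‖V n z.1 z.2‖ ^ 2 * (ν * (Δ (φ z.1)) z.2 +
        timeDeriv φ z.1 z.2) +
        2 * (∑ i, (⟪N n i z.1 z.2, gradient (φ z.1) z.2⟫ * ⟪V n z.1 z.2, b i⟫ +
          φ z.1 z.2 * ⟪fderiv ℝ (V n z.1) z.2 (N n i z.1 z.2), b i⟫)) +
        2 * (Pm n z.1 z.2 * ⟪V n z.1 z.2, gradient (φ z.1) z.2⟫)) := fun n hn =>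
    local_energy_identity_smooth b (ν := ν) ht.1.le (hVsm n) (hNsm n) (hPsm n) hφ hφa
      (fun s hs y hy => (hEQ n hn s hs y hy).1) (fun s hs y hy => (hEQ n hn s hs y hy).2.1)
  -- ### (c) the transport identity `2 ∫∫ φ ⟪G V, V⟫ = -∫∫ |V|² ⟪V, ∇φ⟫`
  have sφ : IsSmoothSpaceTimeOn univ φ := hφ.isSmoothSpaceTimeOn univ
  have cφ : Continuous (uncurry φ) := hφ.contDiff.continuous
  have cgφ : Continuous (uncurry fun s y => gradient (φ s) y) :=
    (sφ.gradient uniqueDiffOn_univ).continuous_uncurry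
  have cΔφ : Continuous (uncurry fun s y => (Δ (φ s)) y) :=
    (sφ.laplacian uniqueDiffOn_univ).continuous_uncurry
  have cTφ : Continuous (uncurry (timeDeriv φ)) := hφ.continuous_timeDeriv
  have hg0 : ∀ s, ∀ y ∉ Kx, gradient (φ s) y = 0 := fun s y hy =>
    gradient_eq_zero_of_notMem_tsupport fun h => hy (hKxt s h)
  have hΔ0 : ∀ s, ∀ y ∉ Kx, (Δ (φ s)) y = 0 := fun s y hy =>
    laplacian_eq_zero_of_notMem_tsupport fun h => hy (hKxt s h)
  have hT0 : ∀ s, ∀ y ∉ Kx, timeDeriv φ s y = 0 := fun s y hy =>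
    timeDeriv_eq_zero_of_forall (fun s' => hφKx s' y hy) s
  have hDAG : ∀ n, (bump n).rOut ≤ ε / 2 →
      2 * ∫ z in Ioo (-1 : ℝ) t ×ˢ (univ : Set E),
          φ z.1 z.2 * ⟪Gm n z.1 z.2 (V n z.1 z.2), V n z.1 z.2⟫ =
      -∫ z in Ioo (-1 : ℝ) t ×ˢ (univ : Set E),
          ‖V n z.1 z.2‖ ^ 2 * ⟪V n z.1 z.2, gradient (φ z.1) z.2⟫ := by
    intro n hn
    -- continuity and `x`-support of both integrands
    have cL : Continuous fun z : ℝ × E => φ z.1 z.2 * ⟪Gm n z.1 z.2 (V n z.1 z.2), V n z.1 z.2⟫ :=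
      cφ.mul ((isBoundedBilinearMap_apply.continuous.comp ((hGc n).prodMk (hVc n))).inner (hVc n))
    have cR : Continuous fun z : ℝ × E => ‖V n z.1 z.2‖ ^ 2 * ⟪V n z.1 z.2, gradient (φ z.1) z.2⟫ :=
      ((hVc n).norm.pow 2).mul ((hVc n).inner cgφ)
    have iL := integrable_prod_of_continuousOn (a := -1) (b := t) hKx cL.continuousOn
      (fun s _ y hy => by simp only [hφKx s y hy, zero_mul])
    have iR := integrable_prod_of_continuousOn (a := -1) (b := t) hKx cR.continuousOn
      (fun s _ y hy => by simp only [hg0 s y hy, inner_zero_right, mul_zero])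
    -- the slice identity
    have hsl' : ∀ s ∈ Ioo (-1 : ℝ) t, 2 * ∫ y, φ s y * ⟪Gm n s y (V n s y), V n s y⟫ =
        -∫ y, ‖V n s y‖ ^ 2 * ⟪V n s y, gradient (φ s) y⟫ := by
      intro s hs
      have hV1 : ContDiff ℝ 1 (V n s) :=
        (contDiff_stMollify_slice (hkinf n) (hkc n) hũi s).of_le one_le_infty
      have hφ1 : ContDiff ℝ 1 (φ s) :=
        (IsSpaceTimeTestOn.contDiff_slice hφ s).of_le one_le_infty
      have key := two_mul_integral_mul_inner_fderiv_self hV1 hφ1 (hφ.hasCompactSupport_slice s)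
        (fun y hy => (hEQ n hn s hs y hy).2.1)
      rw [← key]
      congr 1
      refine integral_congr_ae (Eventually.of_forall fun y => ?_)
      dsimp only
      by_cases hy : φ s y = 0
      · simp only [hy, zero_mul]
      · rw [(hEQ n hn s hs y hy).2.2]
    rw [setIntegral_prod_univ_eq iL, setIntegral_prod_univ_eq iR, ← integral_neg, ← integral_const_mul]
    refine setIntegral_congr_fun measurableSet_Ioo fun s hs => ?_
    exact hsl' s hs
  -- ### (d) passage to the limit along `ns`
  set S : Set (ℝ × E) := Ioo (-1 : ℝ) t ×ˢ (univ : Set E) with hS_def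
  -- the weights and their bounds
  set wΔ : ℝ × E → ℝ := fun z => ν * (Δ (φ z.1)) z.2 + timeDeriv φ z.1 z.2 with hwΔ
  set wφ : ℝ × E → ℝ := fun z => φ z.1 z.2 with hwφ
  set wg : ℝ × E → E →L[ℝ] ℝ := fun z => innerSL ℝ (gradient (φ z.1) z.2) with hwg
  have cwΔ : Continuous wΔ := (continuous_const.mul cΔφ).add cTφ
  have cwg : Continuous wg := (innerSL ℝ).continuous.comp cgφ
  have hsuppφ : HasCompactSupport (uncurry φ) := hφ.hasCompactSupport
  have hw0 : ∀ z, z ∉ tsupport (uncurry φ) → wφ z = 0 ∧ wg z = 0 ∧ wΔ z = 0 := fun z hz => by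
    obtain ⟨h1, h2, h3, h4⟩ := weights_eq_zero_of_notMem_tsupport hz
    refine ⟨h1, ?_, ?_⟩
    · simp only [hwg, h2, map_zero]
    · simp only [hwΔ, h3, h4, mul_zero, add_zero]
  obtain ⟨CΔ, hCΔ⟩ := cwΔ.bounded_above_of_compact_support
    (hsuppφ.mono' fun z hz => by by_contra h; exact hz (hw0 z h).2.2)
  obtain ⟨Cφ, hCφ⟩ := cφ.bounded_above_of_compact_support hsuppφ
  obtain ⟨Cg, hCg⟩ := cwg.bounded_above_of_compact_support
    (hsuppφ.mono' fun z hz => by by_contra h; exact hz (hw0 z h).2.1)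
  have mwΔ : AEStronglyMeasurable wΔ volume := cwΔ.aestronglyMeasurable
  have mwφ : AEStronglyMeasurable wφ volume := cφ.aestronglyMeasurable
  have mwg : AEStronglyMeasurable wg volume := cwg.aestronglyMeasurable
  have bwΔ : ∀ᵐ z ∂(volume : Measure (ℝ × E)), ‖wΔ z‖ ≤ CΔ := Eventually.of_forall hCΔ
  have bwφ : ∀ᵐ z ∂(volume : Measure (ℝ × E)), ‖wφ z‖ ≤ Cφ := Eventually.of_forall hCφ
  have bwg : ∀ᵐ z ∂(volume : Measure (ℝ × E)), ‖wg z‖ ≤ Cg := Eventually.of_forall hCg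
  -- points of `S` where some weight is nonzero lie in `Kt`
  have hKt_of : ∀ z ∈ S, z ∈ tsupport (uncurry φ) → z ∈ Kt := fun z hz hz' =>
    ⟨hz', ⟨le_of_lt (show z.1 < t from hz.1.2), mem_univ _⟩⟩
  -- the bilinear forms
  set βI : E →L[ℝ] E →L[ℝ] ℝ := innerSL ℝ with hβI
  set βev : (E →L[ℝ] E) →L[ℝ] E →L[ℝ] E := ContinuousLinearMap.id ℝ (E →L[ℝ] E) with hβev
  set βb : Fin (finrank ℝ E) → (E →L[ℝ] E) →L[ℝ] E →L[ℝ] ℝ := fun i =>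
    (ContinuousLinearMap.compL ℝ E E ℝ (innerSL ℝ (b i))) with hβb
  set βF : Fin (finrank ℝ E) → (E →L[ℝ] E) →L[ℝ] (E →L[ℝ] E) →L[ℝ] ℝ := fun i =>
    (innerSL ℝ).bilinearComp (ContinuousLinearMap.apply ℝ E (b i))
      (ContinuousLinearMap.apply ℝ E (b i)) with hβF
  set βs : ℝ →L[ℝ] E →L[ℝ] E := ContinuousLinearMap.lsmul ℝ ℝ with hβs
  have βb_apply : ∀ i (L : E →L[ℝ] E) (x : E), βb i L x = ⟪b i, L x⟫ := fun i L x => by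
    simp [hβb]
  have βF_apply : ∀ i (L L' : E →L[ℝ] E), βF i L L' = ⟪L (b i), L' (b i)⟫ := fun i L L' => by
    simp [hβF]
  have βI_apply : ∀ x y : E, βI x y = ⟪x, y⟫ := fun x y => rfl
  have βs_apply : ∀ (a : ℝ) (x : E), βs a x = a • x := fun a x => rfl
  have βev_apply : ∀ (L : E →L[ℝ] E) (x : E), βev L x = L x := fun L x => rfl
  have wg_apply : ∀ (z : ℝ × E) (x : E), wg z x = ⟪gradient (φ z.1) z.2, x⟫ := fun z x => rfl
  -- the limits, term by term (as `n → ∞` through `ns`)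
  have cV2' : Tendsto (fun j => eLpNorm (uncurry (V (ns j)) - ũ) 2 volume) atTop (𝓝 0) :=
    cV2.comp hns.tendsto_atTop
  have cV3' : Tendsto (fun j => eLpNorm (uncurry (V (ns j)) - ũ) 3 volume) atTop (𝓝 0) :=
    cV3.comp hns.tendsto_atTop
  have cP' : Tendsto (fun j => eLpNorm (uncurry (Pm (ns j)) - pt) (3 / 2) volume) atTop (𝓝 0) :=
    cP.comp hns.tendsto_atTop
  have cG' : Tendsto (fun j => eLpNorm (uncurry (Gm (ns j)) - Gt) 2 volume) atTop (𝓝 0) :=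
    cG.comp hns.tendsto_atTop
  have cVQ4' : Tendsto (fun j => eLpNorm (uncurry (VQ (ns j)) - uQ) 4 volume) atTop (𝓝 0) :=
    cVQ4.comp hns.tendsto_atTop
  have cNQ' : ∀ i, Tendsto (fun j => eLpNorm (uncurry (NQm (ns j) i) - NQ i) 2 volume) atTop
      (𝓝 0) := fun i => (cNQ i).comp hns.tendsto_atTop
  -- T1
  have limT1 : Tendsto (fun j => ∫ z in S, wΔ z * βI (uncurry (V (ns j)) z) (uncurry (V (ns j)) z))
      atTop (𝓝 (∫ z in S, wΔ z * βI (ũ z) (ũ z))) :=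
    tendsto_setIntegral_mul_bilin (p := 2) (q := 2) one_le_two βI (fun j => mV2 (ns j)) hũ2
      (fun j => mV2 (ns j)) hũ2 cV2' cV2' mwΔ bwΔ S
  -- T2a
  have limT2a : ∀ i, Tendsto (fun j => ∫ z in S,
      wg z (innerSmulBilin (b i) (uncurry (V (ns j)) z) (uncurry (NQm (ns j) i) z))) atTop
      (𝓝 (∫ z in S, wg z (innerSmulBilin (b i) (ũ z) (NQ i z)))) := fun i =>
    tendsto_setIntegral_clm_bilin (p := 2) (q := 2) one_le_two (innerSmulBilin (b i))
      (fun j => mV2 (ns j)) hũ2 (fun j => mNQ (ns j) i) (hNQ2 i) cV2' (cNQ' i) mwg bwg S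
  -- T2b
  have limT2b : ∀ i, Tendsto (fun j => ∫ z in S,
      wφ z * βb i (uncurry (Gm (ns j)) z) (uncurry (NQm (ns j) i) z)) atTop
      (𝓝 (∫ z in S, wφ z * βb i (Gt z) (NQ i z))) := fun i =>
    tendsto_setIntegral_mul_bilin (p := 2) (q := 2) one_le_two (βb i)
      (fun j => mG (ns j)) hGt2 (fun j => mNQ (ns j) i) (hNQ2 i) cG' (cNQ' i) mwφ bwφ S
  -- LHS2
  have limL2 : ∀ i, Tendsto (fun j => ∫ z in S,
      wφ z * βF i (uncurry (Gm (ns j)) z) (uncurry (Gm (ns j)) z)) atTop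
      (𝓝 (∫ z in S, wφ z * βF i (Gt z) (Gt z))) := fun i =>
    tendsto_setIntegral_mul_bilin (p := 2) (q := 2) one_le_two (βF i)
      (fun j => mG (ns j)) hGt2 (fun j => mG (ns j)) hGt2 cG' cG' mwφ bwφ S
  -- T3
  have limT3 : Tendsto (fun j => ∫ z in S,
      wg z (βs (uncurry (Pm (ns j)) z) (uncurry (V (ns j)) z))) atTop
      (𝓝 (∫ z in S, wg z (βs (pt z) (ũ z)))) :=
    tendsto_setIntegral_clm_bilin (p := 3 / 2) (q := 3) (by norm_num) βs
      (fun j => mP (ns j)) hpt32 (fun j => mV3 (ns j)) hũ3 cP' cV3' mwg bwg S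
  -- DL (two stages)
  have mAm : ∀ j, MemLp (fun z => βev (uncurry (Gm (ns j)) z) (uncurry (VQ (ns j)) z)) (4 / 3)
      volume := fun j => memLp_bilin (p := 2) (q := 4) (r := 4 / 3) βev (mG (ns j)) (mVQ4 (ns j))
  have mA0 : MemLp (fun z => βev (Gt z) (uQ z)) (4 / 3) volume :=
    memLp_bilin (p := 2) (q := 4) (r := 4 / 3) βev hGt2 huQ4
  have one_le_43 : (1 : ℝ≥0∞) ≤ 4 / 3 := by
    have h : (1 : ℝ≥0∞) = 3 / 3 := (ENNReal.div_self (by norm_num) (by norm_num)).symm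
    rw [h]; gcongr; norm_num
  have cAm : Tendsto (fun j => eLpNorm ((fun z => βev (uncurry (Gm (ns j)) z) (uncurry (VQ (ns j)) z)) -
      fun z => βev (Gt z) (uQ z)) (4 / 3) volume) atTop (𝓝 0) := by
    have h := tendsto_eLpNorm_bilin_sub (p := 2) (q := 4) (r := 4 / 3) (by norm_num) one_le_43 βev
      (fun j => (mG (ns j)).1) hGt2.1 (fun j => (mVQ4 (ns j)).1) huQ4.1 hGt2.eLpNorm_lt_top
      huQ4.eLpNorm_lt_top cG' cVQ4'
    exact h
  have limDL : Tendsto (fun j => ∫ z in S, wφ z * βI (βev (uncurry (Gm (ns j)) z)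
      (uncurry (VQ (ns j)) z)) (uncurry (VQ (ns j)) z)) atTop
      (𝓝 (∫ z in S, wφ z * βI (βev (Gt z) (uQ z)) (uQ z))) :=
    tendsto_setIntegral_mul_bilin (p := 4 / 3) (q := 4) (by norm_num) βI mAm mA0
      (fun j => mVQ4 (ns j)) huQ4 cAm cVQ4' mwφ bwφ S
  -- DR (two stages)
  have msq : ∀ j, MemLp (fun z => βI (uncurry (V (ns j)) z) (uncurry (V (ns j)) z)) (3 / 2)
      volume := fun j => memLp_bilin (p := 3) (q := 3) (r := 3 / 2) βI (mV3 (ns j)) (mV3 (ns j))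
  have msq0 : MemLp (fun z => βI (ũ z) (ũ z)) (3 / 2) volume :=
    memLp_bilin (p := 3) (q := 3) (r := 3 / 2) βI hũ3 hũ3
  have csq : Tendsto (fun j => eLpNorm ((fun z => βI (uncurry (V (ns j)) z) (uncurry (V (ns j)) z)) -
      fun z => βI (ũ z) (ũ z)) (3 / 2) volume) atTop (𝓝 0) :=
    tendsto_eLpNorm_bilin_sub (p := 3) (q := 3) (r := 3 / 2) (by norm_num) one_le_three_halves βI
      (fun j => (mV3 (ns j)).1) hũ3.1 (fun j => (mV3 (ns j)).1) hũ3.1 hũ3.eLpNorm_lt_top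
      hũ3.eLpNorm_lt_top cV3' cV3'
  have limDR : Tendsto (fun j => ∫ z in S, wg z (βs (βI (uncurry (V (ns j)) z)
      (uncurry (V (ns j)) z)) (uncurry (V (ns j)) z))) atTop
      (𝓝 (∫ z in S, wg z (βs (βI (ũ z) (ũ z)) (ũ z)))) :=
    tendsto_setIntegral_clm_bilin (p := 3 / 2) (q := 3) (by norm_num) βs msq msq0
      (fun j => mV3 (ns j)) hũ3 csq cV3' mwg bwg S
  -- L1 (the slice at time `t`)
  have limL1 : Tendsto (fun j => ∫ y in (univ : Set E), φ t y * βI (V (ns j) t y) (V (ns j) t y))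
      atTop (𝓝 (∫ y in (univ : Set E), φ t y * βI (ũ (t, y)) (ũ (t, y)))) := by
    have mVt : ∀ j, MemLp (fun y => V (ns j) t y) 2 volume := fun j =>
      ((hVc (ns j)).comp (Continuous.prodMk_right t)).memLp_of_hasCompactSupport
        (hasCompactSupport_slice_of_uncurry (hVcs (ns j)) t)
    have mũt : MemLp (fun y => ũ (t, y)) 2 volume := by
      refine ⟨htm, ?_⟩
      rw [eLpNorm_two_eq_rpow]
      exact ENNReal.rpow_lt_top_of_nonneg (by norm_num) htf.ne
    have hconv : Tendsto (fun j => eLpNorm ((fun y => V (ns j) t y) - fun y => ũ (t, y)) 2 volume)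
        atTop (𝓝 0) := hts
    exact tendsto_setIntegral_mul_bilin (p := 2) (q := 2) one_le_two βI mVt mũt mVt mũt hconv hconv
      (cφ.comp (Continuous.prodMk_right t)).aestronglyMeasurable
      (Eventually.of_forall fun y => hCφ (t, y)) univ
  -- ### (d2) the identities in `T`-form for large `j`
  have hDVKt : ∀ n, (bump n).rOut ≤ ε / 2 → ∀ z ∈ Kt, fderiv ℝ (V n z.1) z.2 = Gm n z.1 z.2 :=
    fun n hn z hz => hG.fderiv_mollified hvI' hGI' (hkinf n) (hkr n)
      ((hballKt _ hz _ hn).trans hQ'Qo)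
  -- pointwise rewriting of the integrands on `S`
  have pwL2 : ∀ n, (bump n).rOut ≤ ε / 2 → ∀ z ∈ S,
      φ z.1 z.2 * frobeniusNormSq (fderiv ℝ (V n z.1) z.2) =
        ∑ i, wφ z * βF i (uncurry (Gm n) z) (uncurry (Gm n) z) := by
    intro n hn z hz
    by_cases hzs : z ∈ tsupport (uncurry φ)
    · rw [hDVKt n hn z (hKt_of z hz hzs), frobeniusNormSq_eq_sum b, Finset.mul_sum]
      refine Finset.sum_congr rfl fun i _ => ?_
      rw [βF_apply, real_inner_self_eq_norm_sq]; rfl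
    · have h0 := (hw0 z hzs).1
      simp only [hwφ] at h0 ⊢
      simp [h0]
  have pwR : ∀ n, (bump n).rOut ≤ ε / 2 → ∀ z ∈ S,
      (‖V n z.1 z.2‖ ^ 2 * (ν * (Δ (φ z.1)) z.2 + timeDeriv φ z.1 z.2) +
        2 * (∑ i, (⟪N n i z.1 z.2, gradient (φ z.1) z.2⟫ * ⟪V n z.1 z.2, b i⟫ +
          φ z.1 z.2 * ⟪fderiv ℝ (V n z.1) z.2 (N n i z.1 z.2), b i⟫)) +
        2 * (Pm n z.1 z.2 * ⟪V n z.1 z.2, gradient (φ z.1) z.2⟫)) =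
      wΔ z * βI (uncurry (V n) z) (uncurry (V n) z) +
        2 * (∑ i, (wg z (innerSmulBilin (b i) (uncurry (V n) z) (uncurry (NQm n i) z)) +
          wφ z * βb i (uncurry (Gm n) z) (uncurry (NQm n i) z))) +
        2 * wg z (βs (uncurry (Pm n) z) (uncurry (V n) z)) := by
    intro n hn z hz
    have e1 : ‖V n z.1 z.2‖ ^ 2 * (ν * (Δ (φ z.1)) z.2 + timeDeriv φ z.1 z.2) =
        wΔ z * βI (uncurry (V n) z) (uncurry (V n) z) := by
      rw [βI_apply, real_inner_self_eq_norm_sq, mul_comm]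
      simp only [hwΔ, uncurry]
    have e3 : Pm n z.1 z.2 * ⟪V n z.1 z.2, gradient (φ z.1) z.2⟫ =
        wg z (βs (uncurry (Pm n) z) (uncurry (V n) z)) := by
      rw [wg_apply, βs_apply, real_inner_smul_right, real_inner_comm]
      simp only [uncurry]
    have e2 : (∑ i, (⟪N n i z.1 z.2, gradient (φ z.1) z.2⟫ * ⟪V n z.1 z.2, b i⟫ +
          φ z.1 z.2 * ⟪fderiv ℝ (V n z.1) z.2 (N n i z.1 z.2), b i⟫)) =
        ∑ i, (wg z (innerSmulBilin (b i) (uncurry (V n) z) (uncurry (NQm n i) z)) +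
          wφ z * βb i (uncurry (Gm n) z) (uncurry (NQm n i) z)) := by
      by_cases hzs : z ∈ tsupport (uncurry φ)
      · have hzK := hKt_of z hz hzs
        obtain ⟨-, hNloc⟩ := hloc n hn z hzK
        refine Finset.sum_congr rfl fun i _ => ?_
        rw [hNloc i, hDVKt n hn z hzK, wg_apply, innerSmulBilin_apply, real_inner_smul_right,
          βb_apply]
        simp only [hwφ, uncurry]
        rw [real_inner_comm (NQm n i z.1 z.2) (gradient (φ z.1) z.2),
          real_inner_comm (Gm n z.1 z.2 (NQm n i z.1 z.2)) (b i)]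
        ring
      · obtain ⟨h0, hg0', -⟩ := hw0 z hzs
        have hg' : gradient (φ z.1) z.2 = 0 := (weights_eq_zero_of_notMem_tsupport hzs).2.1
        refine Finset.sum_congr rfl fun i _ => ?_
        simp only [hwφ] at h0
        simp only [hg', h0, hg0', inner_zero_right, zero_mul, _root_.zero_apply, hwφ, zero_add]
    rw [e1, e2, e3]
  have pwDL : ∀ n, (bump n).rOut ≤ ε / 2 → ∀ z ∈ S,
      φ z.1 z.2 * ⟪Gm n z.1 z.2 (V n z.1 z.2), V n z.1 z.2⟫ =
        wφ z * βI (βev (uncurry (Gm n) z) (uncurry (VQ n) z)) (uncurry (VQ n) z) := by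
    intro n hn z hz
    by_cases hzs : z ∈ tsupport (uncurry φ)
    · obtain ⟨hVloc, -⟩ := hloc n hn z (hKt_of z hz hzs)
      rw [hVloc]; rfl
    · have h0 := (hw0 z hzs).1
      simp only [hwφ] at h0 ⊢
      simp [h0]
  have pwDR : ∀ n (z : ℝ × E), ‖V n z.1 z.2‖ ^ 2 * ⟪V n z.1 z.2, gradient (φ z.1) z.2⟫ =
      wg z (βs (βI (uncurry (V n) z) (uncurry (V n) z)) (uncurry (V n) z)) := by
    intro n z
    rw [wg_apply, βs_apply, βI_apply, real_inner_smul_right, real_inner_self_eq_norm_sq,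
      real_inner_comm]
    simp only [uncurry]
  have pwL1 : ∀ n (y : E), φ t y * ‖V n t y‖ ^ 2 = φ t y * βI (V n t y) (V n t y) := fun n y => by
    rw [βI_apply, real_inner_self_eq_norm_sq]
  -- integrability of the pieces (globally, hence on `S`)
  have iT2a : ∀ n i, Integrable (fun z => wg z (innerSmulBilin (b i) (uncurry (V n) z)
      (uncurry (NQm n i) z))) (volume : Measure (ℝ × E)) := fun n i =>
    integrable_clm_bilin_of_memLp (p := 2) (q := 2) _ (mV2 n) (mNQ n i) mwg bwg
  have iT2b : ∀ n i, Integrable (fun z => wφ z * βb i (uncurry (Gm n) z) (uncurry (NQm n i) z))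
      (volume : Measure (ℝ × E)) := fun n i =>
    integrable_mul_bilin_of_memLp (p := 2) (q := 2) _ (mG n) (mNQ n i) mwφ bwφ
  have iT1 : ∀ n, Integrable (fun z => wΔ z * βI (uncurry (V n) z) (uncurry (V n) z))
      (volume : Measure (ℝ × E)) := fun n =>
    integrable_mul_bilin_of_memLp (p := 2) (q := 2) _ (mV2 n) (mV2 n) mwΔ bwΔ
  have iT3 : ∀ n, Integrable (fun z => wg z (βs (uncurry (Pm n) z) (uncurry (V n) z)))
      (volume : Measure (ℝ × E)) := fun n =>
    integrable_clm_bilin_of_memLp (p := 3 / 2) (q := 3) _ (mP n) (mV3 n) mwg bwg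
  have iL2 : ∀ n i, Integrable (fun z => wφ z * βF i (uncurry (Gm n) z) (uncurry (Gm n) z))
      (volume : Measure (ℝ × E)) := fun n i =>
    integrable_mul_bilin_of_memLp (p := 2) (q := 2) _ (mG n) (mG n) mwφ bwφ
  -- the identities in `T`-form
  have hIDT : ∀ j, (bump (ns j)).rOut ≤ ε / 2 →
      (∫ y in (univ : Set E), φ t y * βI (V (ns j) t y) (V (ns j) t y)) +
        2 * ν * ∑ i, ∫ z in S, wφ z * βF i (uncurry (Gm (ns j)) z) (uncurry (Gm (ns j)) z) =
      (∫ z in S, wΔ z * βI (uncurry (V (ns j)) z) (uncurry (V (ns j)) z)) +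
        2 * ((∑ i, ∫ z in S, wg z (innerSmulBilin (b i) (uncurry (V (ns j)) z)
          (uncurry (NQm (ns j) i) z))) +
          ∑ i, ∫ z in S, wφ z * βb i (uncurry (Gm (ns j)) z) (uncurry (NQm (ns j) i) z)) +
        2 * ∫ z in S, wg z (βs (uncurry (Pm (ns j)) z) (uncurry (V (ns j)) z)) := by
    intro j hj
    set n := ns j with hn_def
    have h := hID n hj
    -- left-hand side
    have eL1 : ∫ y, φ t y * ‖V n t y‖ ^ 2 = ∫ y in (univ : Set E), φ t y * βI (V n t y) (V n t y) := by
      rw [Measure.restrict_univ]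
      exact integral_congr_ae (Eventually.of_forall (pwL1 n))
    have eL2 : ∫ z in S, φ z.1 z.2 * frobeniusNormSq (fderiv ℝ (V n z.1) z.2) =
        ∑ i, ∫ z in S, wφ z * βF i (uncurry (Gm n) z) (uncurry (Gm n) z) := by
      rw [setIntegral_congr_fun (measurableSet_Ioo.prod MeasurableSet.univ) (pwL2 n hj),
        integral_finsetSum _ fun i _ => (iL2 n i).integrableOn]
    have eR : ∫ z in S, (‖V n z.1 z.2‖ ^ 2 * (ν * (Δ (φ z.1)) z.2 + timeDeriv φ z.1 z.2) +
        2 * (∑ i, (⟪N n i z.1 z.2, gradient (φ z.1) z.2⟫ * ⟪V n z.1 z.2, b i⟫ +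
          φ z.1 z.2 * ⟪fderiv ℝ (V n z.1) z.2 (N n i z.1 z.2), b i⟫)) +
        2 * (Pm n z.1 z.2 * ⟪V n z.1 z.2, gradient (φ z.1) z.2⟫)) =
        (∫ z in S, wΔ z * βI (uncurry (V n) z) (uncurry (V n) z)) +
        2 * ((∑ i, ∫ z in S, wg z (innerSmulBilin (b i) (uncurry (V n) z) (uncurry (NQm n i) z))) +
          ∑ i, ∫ z in S, wφ z * βb i (uncurry (Gm n) z) (uncurry (NQm n i) z)) +
        2 * ∫ z in S, wg z (βs (uncurry (Pm n) z) (uncurry (V n) z)) := by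
      rw [setIntegral_congr_fun (measurableSet_Ioo.prod MeasurableSet.univ) (pwR n hj)]
      have iS : Integrable (fun z => ∑ i, (wg z (innerSmulBilin (b i) (uncurry (V n) z)
          (uncurry (NQm n i) z)) + wφ z * βb i (uncurry (Gm n) z) (uncurry (NQm n i) z)))
          (volume.restrict S) :=
        integrable_finsetSum _ fun i _ => ((iT2a n i).add (iT2b n i)).integrableOn
      have i1 : Integrable (fun z => wΔ z * βI (uncurry (V n) z) (uncurry (V n) z))
          (volume.restrict S) := (iT1 n).integrableOn
      have i2 : Integrable (fun z => 2 * ∑ i, (wg z (innerSmulBilin (b i) (uncurry (V n) z)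
          (uncurry (NQm n i) z)) + wφ z * βb i (uncurry (Gm n) z) (uncurry (NQm n i) z)))
          (volume.restrict S) := iS.const_mul 2
      have i3 : Integrable (fun z => 2 * wg z (βs (uncurry (Pm n) z) (uncurry (V n) z)))
          (volume.restrict S) := (iT3 n).integrableOn.const_mul 2
      have i12 : Integrable (fun z => wΔ z * βI (uncurry (V n) z) (uncurry (V n) z) +
          2 * ∑ i, (wg z (innerSmulBilin (b i) (uncurry (V n) z)
          (uncurry (NQm n i) z)) + wφ z * βb i (uncurry (Gm n) z) (uncurry (NQm n i) z)))
          (volume.restrict S) := i1.add i2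
      have iTi : ∀ i ∈ Finset.univ, Integrable (fun z => wg z (innerSmulBilin (b i) (uncurry (V n) z)
          (uncurry (NQm n i) z)) + wφ z * βb i (uncurry (Gm n) z) (uncurry (NQm n i) z))
          (volume.restrict S) := fun i _ => ((iT2a n i).add (iT2b n i)).integrableOn
      rw [integral_add i12 i3, integral_add i1 i2, integral_const_mul, integral_const_mul,
        integral_finsetSum _ iTi]
      congr 2
      congr 1
      rw [← Finset.sum_add_distrib]
      refine Finset.sum_congr rfl fun i _ => ?_
      exact integral_add (iT2a n i).integrableOn (iT2b n i).integrableOn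
    rw [← eL1, ← eL2, ← eR]
    exact h
  have hDAGT : ∀ j, (bump (ns j)).rOut ≤ ε / 2 →
      2 * ∫ z in S, wφ z * βI (βev (uncurry (Gm (ns j)) z) (uncurry (VQ (ns j)) z))
          (uncurry (VQ (ns j)) z) =
      -∫ z in S, wg z (βs (βI (uncurry (V (ns j)) z) (uncurry (V (ns j)) z))
          (uncurry (V (ns j)) z)) := by
    intro j hj
    have h := hDAG (ns j) hj
    rw [setIntegral_congr_fun (measurableSet_Ioo.prod MeasurableSet.univ) (pwDL (ns j) hj),
      integral_congr_ae (Eventually.of_forall (pwDR (ns j)))] at h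
    exact h
  -- ### the limit identities
  have hev : ∀ᶠ j in atTop, (bump (ns j)).rOut ≤ ε / 2 :=
    ((tendsto_order.1 hbrs).2 (ε / 2) (by linarith)).mono fun j hj => hj.le
  have I1 : (∫ y in (univ : Set E), φ t y * βI (ũ (t, y)) (ũ (t, y))) +
      2 * ν * ∑ i, ∫ z in S, wφ z * βF i (Gt z) (Gt z) =
      (∫ z in S, wΔ z * βI (ũ z) (ũ z)) +
      2 * ((∑ i, ∫ z in S, wg z (innerSmulBilin (b i) (ũ z) (NQ i z))) +
        ∑ i, ∫ z in S, wφ z * βb i (Gt z) (NQ i z)) +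
      2 * ∫ z in S, wg z (βs (pt z) (ũ z)) := by
    refine tendsto_nhds_unique_of_eventuallyEq
      (limL1.add ((tendsto_finsetSum _ fun i _ => limL2 i).const_mul _))
      ((limT1.add (((tendsto_finsetSum _ fun i _ => limT2a i).add
        (tendsto_finsetSum _ fun i _ => limT2b i)).const_mul _)).add (limT3.const_mul _))
      (hev.mono fun j hj => hIDT j hj)
  have I2 : 2 * ∫ z in S, wφ z * βI (βev (Gt z) (uQ z)) (uQ z) =
      -∫ z in S, wg z (βs (βI (ũ z) (ũ z)) (ũ z)) :=
    tendsto_nhds_unique_of_eventuallyEq (limDL.const_mul _) limDR.neg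
      (hev.mono fun j hj => hDAGT j hj)
  -- ### (e) identification of the limits
  set Sω : Set (ℝ × E) := Ioo (-1 : ℝ) t ×ˢ (ω : Set E) with hSω_def
  have hSm : MeasurableSet S := measurableSet_Ioo.prod MeasurableSet.univ
  have hSωm : MeasurableSet Sω := measurableSet_Ioo.prod ω.isOpen.measurableSet
  have hSωS : Sω ⊆ S := prod_mono Subset.rfl (subset_univ _)
  have hSωQ : Sω ⊆ Ioo (-1 : ℝ) 0 ×ˢ ball (0 : E) 1 := by
    rw [hSω_def, hω]; exact prod_mono (Ioo_subset_Ioo le_rfl ht.2.le) Subset.rfl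
  have honQ : ∀ z ∈ Sω, z ∈ (Qo : Set (ℝ × E)) := fun z hz => by rw [hQ]; exact hSωQ hz
  have hoff : ∀ z ∈ S \ Sω, z ∉ tsupport (uncurry φ) := by
    rintro z ⟨hzS, hzω⟩ hzs
    have hz : z ∈ (forwardCylinder ω (-1) : Set (ℝ × E)) := hφ.tsupport_subset hzs
    rw [coe_forwardCylinder] at hz
    exact hzω ⟨hzS.1, hz.2⟩
  have hũv : ∀ z ∈ Sω, ũ z = v z.1 z.2 := fun z hz => zeroExt_of_mem _ (honQ z hz)
  have hptp : ∀ z ∈ Sω, pt z = p z.1 z.2 := fun z hz => zeroExt_of_mem _ (honQ z hz)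
  have hGtG : ∀ z ∈ Sω, Gt z = G z.1 z.2 := fun z hz => zeroExt_of_mem _ (honQ z hz)
  have huQũ : ∀ z ∈ S, z ∈ tsupport (uncurry φ) → uQ z = ũ z := fun z hz hzs => by
    rw [huQ, indicator_of_mem (hKtQ' (hKt_of z hz hzs))]
  -- restriction from `S` to `Sω` for integrands carrying a weight
  have hrestr : ∀ {f : ℝ × E → ℝ}, (∀ z, z ∉ tsupport (uncurry φ) → f z = 0) →
      ∫ z in S, f z = ∫ z in Sω, f z := fun {f} hf =>
    setIntegral_eq_of_subset_of_forall_sdiff_eq_zero hSm hSωS fun z hz => hf z (hoff z hz)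
  -- cL1
  have cL1 : ∫ y in (univ : Set E), φ t y * βI (ũ (t, y)) (ũ (t, y)) =
      ∫ x in (ω : Set E), φ t x * ‖v t x‖ ^ 2 := by
    rw [setIntegral_eq_of_subset_of_forall_sdiff_eq_zero MeasurableSet.univ (subset_univ (ω : Set E))]
    · refine setIntegral_congr_fun ω.isOpen.measurableSet fun y hy => ?_
      have hty : ((t, y) : ℝ × E) ∈ (Qo : Set (ℝ × E)) := by
        rw [hQ]; refine ⟨ht, ?_⟩; rw [hω] at hy; exact hy
      have : ũ (t, y) = v t y := zeroExt_of_mem _ hty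
      rw [βI_apply, real_inner_self_eq_norm_sq, this]
    · rintro y ⟨-, hy⟩
      have : φ t y = 0 := by
        by_contra h
        rw [hω] at hy
        exact hy (hω' h).2
      rw [this, zero_mul]
  -- cL2
  have iL2inf : ∀ i, Integrable (fun z => wφ z * βF i (Gt z) (Gt z)) (volume : Measure (ℝ × E)) :=
    fun i => integrable_mul_bilin_of_memLp (p := 2) (q := 2) _ hGt2 hGt2 mwφ bwφ
  have cL2 : ∑ i, ∫ z in S, wφ z * βF i (Gt z) (Gt z) =
      ∫ z in Sω, φ z.1 z.2 * frobeniusNormSq (G z.1 z.2) := by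
    rw [← integral_finsetSum _ fun i _ => (iL2inf i).integrableOn]
    rw [hrestr (fun z hz => by
      simp only [hwφ] at *; simp [(hw0 z hz).1] )]
    refine setIntegral_congr_fun hSωm fun z hz => ?_
    rw [hGtG z hz, frobeniusNormSq_eq_sum b, Finset.mul_sum]
    refine Finset.sum_congr rfl fun i _ => ?_
    rw [βF_apply, real_inner_self_eq_norm_sq]
  -- cT1
  have cT1 : ∫ z in S, wΔ z * βI (ũ z) (ũ z) =
      ∫ z in Sω, ‖v z.1 z.2‖ ^ 2 * (ν * (Δ (φ z.1)) z.2 + timeDeriv φ z.1 z.2) := by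
    rw [hrestr (fun z hz => by rw [(hw0 z hz).2.2, zero_mul])]
    refine setIntegral_congr_fun hSωm fun z hz => ?_
    rw [βI_apply, real_inner_self_eq_norm_sq, hũv z hz, mul_comm]
  -- cDR
  have cDR : ∫ z in S, wg z (βs (βI (ũ z) (ũ z)) (ũ z)) =
      ∫ z in Sω, ‖v z.1 z.2‖ ^ 2 * ⟪v z.1 z.2, gradient (φ z.1) z.2⟫ := by
    rw [hrestr (fun z hz => by rw [(hw0 z hz).2.1, _root_.zero_apply])]
    refine setIntegral_congr_fun hSωm fun z hz => ?_
    rw [wg_apply, βs_apply, βI_apply, real_inner_smul_right, real_inner_self_eq_norm_sq, hũv z hz,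
      real_inner_comm]
  -- cT3
  have cT3 : ∫ z in S, wg z (βs (pt z) (ũ z)) =
      ∫ z in Sω, p z.1 z.2 * ⟪v z.1 z.2, gradient (φ z.1) z.2⟫ := by
    rw [hrestr (fun z hz => by rw [(hw0 z hz).2.1, _root_.zero_apply])]
    refine setIntegral_congr_fun hSωm fun z hz => ?_
    rw [wg_apply, βs_apply, real_inner_smul_right, hũv z hz, hptp z hz, real_inner_comm]
  -- I3: `Σᵢ T2b∞(i) = DL∞`
  have iT2binf : ∀ i, Integrable (fun z => wφ z * βb i (Gt z) (NQ i z)) (volume : Measure (ℝ × E)) :=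
    fun i => integrable_mul_bilin_of_memLp (p := 2) (q := 2) _ hGt2 (hNQ2 i) mwφ bwφ
  have I3 : ∑ i, ∫ z in S, wφ z * βb i (Gt z) (NQ i z) =
      ∫ z in S, wφ z * βI (βev (Gt z) (uQ z)) (uQ z) := by
    rw [← integral_finsetSum _ fun i _ => (iT2binf i).integrableOn]
    refine integral_congr_ae (Eventually.of_forall fun z => ?_)
    show (∑ i, wφ z * βb i (Gt z) (NQ i z)) = wφ z * βI (βev (Gt z) (uQ z)) (uQ z)
    rw [← Finset.mul_sum]
    congr 1
    rw [βI_apply, βev_apply]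
    have e : ∀ i, βb i (Gt z) (NQ i z) = ⟪uQ z, b i⟫ * ⟪b i, Gt z (uQ z)⟫ := fun i => by
      rw [βb_apply]
      change ⟪b i, Gt z (⟪uQ z, b i⟫ • uQ z)⟫ = _
      rw [map_smul, real_inner_smul_right]
    simp_rw [e]
    rw [b.sum_inner_mul_inner, real_inner_comm]
  -- I4: `Σᵢ T2a∞(i) = DR∞`
  have iT2ainf : ∀ i, Integrable (fun z => wg z (innerSmulBilin (b i) (ũ z) (NQ i z)))
      (volume : Measure (ℝ × E)) := fun i =>
    integrable_clm_bilin_of_memLp (p := 2) (q := 2) _ hũ2 (hNQ2 i) mwg bwg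
  have I4 : ∑ i, ∫ z in S, wg z (innerSmulBilin (b i) (ũ z) (NQ i z)) =
      ∫ z in S, wg z (βs (βI (ũ z) (ũ z)) (ũ z)) := by
    rw [← integral_finsetSum _ fun i _ => (iT2ainf i).integrableOn]
    refine setIntegral_congr_fun hSm fun z hz => ?_
    show (∑ i, wg z (innerSmulBilin (b i) (ũ z) (NQ i z))) = wg z (βs (βI (ũ z) (ũ z)) (ũ z))
    by_cases hzs : z ∈ tsupport (uncurry φ)
    · have hu : uQ z = ũ z := huQũ z hz hzs
      have e : ∀ i, innerSmulBilin (b i) (ũ z) (NQ i z) = (⟪ũ z, b i⟫ ^ 2) • ũ z :=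
        fun i => by
        rw [innerSmulBilin_apply]
        change ⟪ũ z, b i⟫ • (⟪uQ z, b i⟫ • uQ z) = _
        rw [hu, smul_smul, sq]
      have e2 : βs (βI (ũ z) (ũ z)) (ũ z) = (∑ i, ⟪ũ z, b i⟫ ^ 2) • ũ z := by
        rw [βs_apply, βI_apply, real_inner_self_eq_norm_sq, b.sum_sq_inner_left]
      simp_rw [e]
      rw [← map_sum, ← Finset.sum_smul, e2]
    · rw [(hw0 z hzs).2.1]
      simp
  -- integrability of the target integrands on `Sω`
  have iA : IntegrableOn (fun z : ℝ × E => ‖v z.1 z.2‖ ^ 2 * (ν * (Δ (φ z.1)) z.2 +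
      timeDeriv φ z.1 z.2)) Sω volume := by
    refine ((integrable_mul_bilin_of_memLp (p := 2) (q := 2) βI hũ2 hũ2 mwΔ bwΔ).integrableOn).congr_fun
      (fun z hz => ?_) hSωm
    show wΔ z * βI (ũ z) (ũ z) = _
    rw [βI_apply, real_inner_self_eq_norm_sq, hũv z hz, mul_comm]
  have iB1 : IntegrableOn (fun z : ℝ × E => ‖v z.1 z.2‖ ^ 2 * ⟪v z.1 z.2, gradient (φ z.1) z.2⟫)
      Sω volume := by
    refine ((integrable_clm_bilin_of_memLp (p := 3 / 2) (q := 3) βs msq0 hũ3 mwg bwg).integrableOn).congr_fun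
      (fun z hz => ?_) hSωm
    show wg z (βs (βI (ũ z) (ũ z)) (ũ z)) = _
    rw [wg_apply, βs_apply, βI_apply, real_inner_smul_right, real_inner_self_eq_norm_sq, hũv z hz,
      real_inner_comm]
  have iB2 : IntegrableOn (fun z : ℝ × E => p z.1 z.2 * ⟪v z.1 z.2, gradient (φ z.1) z.2⟫)
      Sω volume := by
    refine ((integrable_clm_bilin_of_memLp (p := 3 / 2) (q := 3) βs hpt32 hũ3 mwg bwg).integrableOn).congr_fun
      (fun z hz => ?_) hSωm
    show wg z (βs (pt z) (ũ z)) = _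
    rw [wg_apply, βs_apply, real_inner_smul_right, hũv z hz, hptp z hz, real_inner_comm]
  -- the target right-hand side, split
  have hRHS : ∫ z in Sω, (‖v z.1 z.2‖ ^ 2 * (ν * (Δ (φ z.1)) z.2 + timeDeriv φ z.1 z.2) +
      ⟪v z.1 z.2, gradient (φ z.1) z.2⟫ * (‖v z.1 z.2‖ ^ 2 + 2 * p z.1 z.2)) =
      (∫ z in Sω, ‖v z.1 z.2‖ ^ 2 * (ν * (Δ (φ z.1)) z.2 + timeDeriv φ z.1 z.2)) +
      ((∫ z in Sω, ‖v z.1 z.2‖ ^ 2 * ⟪v z.1 z.2, gradient (φ z.1) z.2⟫) +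
        2 * ∫ z in Sω, p z.1 z.2 * ⟪v z.1 z.2, gradient (φ z.1) z.2⟫) := by
    have e : ∀ z : ℝ × E, ⟪v z.1 z.2, gradient (φ z.1) z.2⟫ * (‖v z.1 z.2‖ ^ 2 + 2 * p z.1 z.2) =
        ‖v z.1 z.2‖ ^ 2 * ⟪v z.1 z.2, gradient (φ z.1) z.2⟫ +
          2 * (p z.1 z.2 * ⟪v z.1 z.2, gradient (φ z.1) z.2⟫) := fun z => by ring
    simp_rw [e]
    have iB2' : Integrable (fun z : ℝ × E => 2 * (p z.1 z.2 * ⟪v z.1 z.2, gradient (φ z.1) z.2⟫))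
        (volume.restrict Sω) := iB2.const_mul 2
    have iB12 : Integrable (fun z : ℝ × E => ‖v z.1 z.2‖ ^ 2 * ⟪v z.1 z.2, gradient (φ z.1) z.2⟫ +
        2 * (p z.1 z.2 * ⟪v z.1 z.2, gradient (φ z.1) z.2⟫)) (volume.restrict Sω) := iB1.add iB2'
    rw [integral_add iA iB12, integral_add iB1 iB2', integral_const_mul]
  -- conclusion
  rw [cL2] at I1
  refine le_antisymm ?_ ?_ <;> linarith [cL1, hRHS, cT1, cDR, cT3, I1, I2, I3, I4]


/-! ### The iterated form: CKN (2.5) with equality for every test function on the cylinder -/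

/-- **THE LIONS GATE, ITERATED FORM (CKN (2.5) WITH EQUALITY).**  Under the hypotheses of
`ae_localEnergyEquality_of_L4` (any viscosity `ν`, any dimension; `v ∈ L_{2,∞} ∩ L⁴` on the unit cylinder `Q₁ = (−1,0) × B(0,1)`,
a square-integrable weak spatial gradient `G`, `p ∈ L^{3/2}`), every test function `φ ∈ C_c^∞(Q₁)` satisfies the local energy
identity of Caffarelli–Kohn–Nirenberg ((2.5), written as in `IsSuitableWeakSolutionOn.localEnergy`) WITH EQUALITY:
`∫ dt ∫ dx (|v|²(νΔφ + ∂ₜφ) + ⟪v, ∇φ⟫(|v|² + 2p)) = 2ν ∫ dt ∫ dx φ |∇v|²_F`.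
Proof: the support of `φ` keeps a margin `ε` from `t = 0` (`exists_margin_of_isCompact`); take a good time `t ∈ (−ε, 0)` of the
sliced identity (a.e. `t` is good and `(−ε,0)` has positive measure): the slice term vanishes, the set integrals over
`(−1,t) × B₁` are whole-space integrals (the integrands vanish off the support), and Fubini (`integral_prod`; the integrands are
integrable: `v ∈ L²∩L³`, `p ∈ L^{3/2}`, `G ∈ L²` against bounded compactly supported weights). [cite: EscauriazaSereginSverak2003, §3, proof of Thm. 1.4, first paragraph] -/
theorem integral_integral_localEnergy_eq_of_L4 [Nontrivial E] {ν : ℝ} {v : ℝ → E → E} {p : ℝ → E → ℝ}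
    {G : ℝ → E → E →L[ℝ] E}
    (hNS : IsDistributionalNSSolutionOn (parabolicCylinderOpens 1 ((0 : ℝ), (0 : E))) ν 0 v p)
    (h2 : ∃ C : ℝ≥0, ∀ᵐ t ∂(volume.restrict (Ioo (-1 : ℝ) 0)),
      ∫⁻ x in ball (0 : E) 1, ‖v t x‖ₑ ^ 2 ≤ C)
    (hG : HasWeakSpatialGradientOn (parabolicCylinderOpens 1 ((0 : ℝ), (0 : E))) v G)
    (hG2 : ∫⁻ z in parabolicCylinder 1 ((0 : ℝ), (0 : E)),
      ENNReal.ofReal (frobeniusNormSq (G z.1 z.2)) < ∞)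
    (hp : ∫⁻ z in parabolicCylinder 1 ((0 : ℝ), (0 : E)), ‖p z.1 z.2‖ₑ ^ (3 / 2 : ℝ) < ∞)
    (h4Q : ∫⁻ z in parabolicCylinder 1 ((0 : ℝ), (0 : E)), ‖v z.1 z.2‖ₑ ^ (4 : ℝ) < ∞)
    {φ : ℝ → E → ℝ} (hφ : IsSpaceTimeTestOn (parabolicCylinderOpens 1 ((0 : ℝ), (0 : E))) φ) :
    ∫ t, ∫ x, (‖v t x‖ ^ 2 * (ν * (Δ (φ t)) x + timeDeriv φ t x) +
        ⟪v t x, gradient (φ t) x⟫ * (‖v t x‖ ^ 2 + 2 * p t x)) =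
      2 * ν * ∫ t, ∫ x, φ t x * frobeniusNormSq (G t x) := by
  have one_le_three_halves : (1 : ℝ≥0∞) ≤ 3 / 2 := by
    have h : (1 : ℝ≥0∞) = 2 / 2 := (ENNReal.div_self two_ne_zero ENNReal.ofNat_ne_top).symm
    rw [h]
    gcongr
    norm_num
  have three_halves_ne_top : (3 / 2 : ℝ≥0∞) ≠ ∞ := ENNReal.div_ne_top (by norm_num) (by norm_num)
  have three_halves_ne_zero : (3 / 2 : ℝ≥0∞) ≠ 0 :=
    (ENNReal.div_pos (by norm_num) (by norm_num)).ne'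
  haveI : (volume : Measure (ℝ × E)).IsAddHaarMeasure := Measure.prod.instIsAddHaarMeasure _ _
  set b := stdOrthonormalBasis ℝ E with hb
  set Qo : Opens (ℝ × E) := parabolicCylinderOpens 1 ((0 : ℝ), (0 : E)) with hQo
  have hQ : (Qo : Set (ℝ × E)) = Ioo (-1 : ℝ) 0 ×ˢ ball (0 : E) 1 := by
    rw [hQo, coe_parabolicCylinderOpens, parabolicCylinder_one_zero]
  have hQ' : parabolicCylinder 1 ((0 : ℝ), (0 : E)) = Ioo (-1 : ℝ) 0 ×ˢ ball (0 : E) 1 :=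
    parabolicCylinder_one_zero
  have hQm : MeasurableSet (Ioo (-1 : ℝ) 0 ×ˢ ball (0 : E) 1) :=
    measurableSet_Ioo.prod measurableSet_ball
  -- the unit ball as an open set, and `φ` as a test on the forward cylinder
  set ω : Opens E := ⟨ball (0 : E) 1, isOpen_ball⟩ with hωdef
  have hω : (ω : Set E) = ball (0 : E) 1 := rfl
  have hφ' : IsSpaceTimeTestOn (forwardCylinder ω (-1)) φ := by
    refine hφ.mono ?_
    intro z hz
    have hz' : z ∈ (Qo : Set (ℝ × E)) := hz
    rw [hQ] at hz'
    show z ∈ ((forwardCylinder ω (-1) : Opens (ℝ × E)) : Set (ℝ × E))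
    rw [coe_forwardCylinder]
    exact ⟨hz'.1.1, hz'.2⟩
  -- the sliced identity for a.e. `t`
  have hae := ae_localEnergyEquality_of_L4 hω hNS h2 hG hG2 hp h4Q
  -- support geometry: a margin `ε` below `t = 0`
  set K : Set (ℝ × E) := tsupport (uncurry φ) with hK
  have hKc : IsCompact K := hφ.hasCompactSupport
  have hKQ : K ⊆ Ioo (-1 : ℝ) 0 ×ˢ ball (0 : E) 1 := by rw [← hQ]; exact hφ.tsupport_subset
  obtain ⟨ε, hε, hε1, hmargin⟩ := exists_margin_of_isCompact hKc hKQ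
  -- a good time in `(−ε, 0)`
  have hsub : Ioo (-ε) (0 : ℝ) ⊆ Ioo (-1) 0 := Ioo_subset_Ioo (by linarith) le_rfl
  haveI : (ae ((volume : Measure ℝ).restrict (Ioo (-ε) (0 : ℝ)))).NeBot := by
    rw [ae_neBot, Ne, Measure.restrict_eq_zero, Real.volume_Ioo]
    simp [hε]
  obtain ⟨t, ht, hid⟩ := ((ae_restrict_mem measurableSet_Ioo).and
    (ae_restrict_of_ae_restrict_of_subset hsub hae)).exists
  have hidt := hid φ hφ'
  -- the slice term vanishes: `φ(t, ·) = 0`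
  have hφt : ∀ x, φ t x = 0 := fun x => by
    by_contra h
    have hz : ((t, x) : ℝ × E) ∈ K := subset_tsupport _ (by simpa [uncurry] using h)
    have := (hmargin _ hz).2.1
    simp only at this
    linarith [ht.1]
  have hL1 : ∫ x in (ω : Set E), φ t x * ‖v t x‖ ^ 2 = 0 := by
    simp only [hφt, zero_mul, integral_zero]
  -- the set `S = (−1, t) × B₁` contains the support
  set S : Set (ℝ × E) := Ioo (-1 : ℝ) t ×ˢ (ω : Set E) with hS
  have hKS : K ⊆ S := fun z hz => by
    have h1 := hKQ hz
    have h2 := (hmargin z hz).2.1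
    exact ⟨⟨h1.1.1, by linarith [ht.1]⟩, h1.2⟩
  have hw0 : ∀ z, z ∉ K →
      φ z.1 z.2 = 0 ∧ gradient (φ z.1) z.2 = 0 ∧ (Δ (φ z.1)) z.2 = 0 ∧ timeDeriv φ z.1 z.2 = 0 :=
    fun z hz => weights_eq_zero_of_notMem_tsupport hz
  -- the integrands
  set FR : ℝ × E → ℝ := fun z => ‖v z.1 z.2‖ ^ 2 * (ν * (Δ (φ z.1)) z.2 + timeDeriv φ z.1 z.2) +
    ⟪v z.1 z.2, gradient (φ z.1) z.2⟫ * (‖v z.1 z.2‖ ^ 2 + 2 * p z.1 z.2) with hFR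
  set FL : ℝ × E → ℝ := fun z => φ z.1 z.2 * frobeniusNormSq (G z.1 z.2) with hFL
  have hFR0 : ∀ z, z ∉ K → FR z = 0 := fun z hz => by
    obtain ⟨h1, h2, h3, h4⟩ := hw0 z hz
    simp only [hFR, h2, h3, h4, inner_zero_right, mul_zero, zero_mul, add_zero]
  have hFL0 : ∀ z, z ∉ K → FL z = 0 := fun z hz => by
    simp only [hFL, (hw0 z hz).1, zero_mul]
  have eR : ∫ z in S, FR z = ∫ z, FR z :=
    setIntegral_eq_integral_of_forall_compl_eq_zero fun z hz => hFR0 z fun h => hz (hKS h)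
  have eL : ∫ z in S, FL z = ∫ z, FL z :=
    setIntegral_eq_integral_of_forall_compl_eq_zero fun z hz => hFL0 z fun h => hz (hKS h)
  -- the identity in whole-space form
  have hidS : 2 * ν * ∫ z, FL z = ∫ z, FR z := by
    rw [← eL, ← eR, hS, hFL, hFR]
    have h := hidt
    rw [hL1, zero_add] at h
    exact h
  -- ## integrability of `FR` and `FL` on `ℝ × E` (zero extensions, bounded weights, Hölder)
  have hIfin : volume (Ioo (-1 : ℝ) 0) < ∞ := measure_Ioo_lt_top
  haveI : IsFiniteMeasure (volume.restrict (Ioo (-1 : ℝ) 0 ×ˢ ball (0 : E) 1)) := by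
    refine ⟨?_⟩
    rw [Measure.restrict_apply_univ, Measure.volume_eq_prod, Measure.prod_prod]
    exact ENNReal.mul_lt_top measure_Ioo_lt_top measure_ball_lt_top
  obtain ⟨C₂, h2⟩ := h2
  rw [hQ'] at hG2 hp h4Q
  have hvm : AEStronglyMeasurable (uncurry v) (volume.restrict (Ioo (-1 : ℝ) 0 ×ˢ ball (0 : E) 1)) := by
    have := hNS.1.aestronglyMeasurable; rwa [hQ] at this
  have hpm : AEStronglyMeasurable (uncurry p) (volume.restrict (Ioo (-1 : ℝ) 0 ×ˢ ball (0 : E) 1)) := by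
    have := hNS.2.2.1.aestronglyMeasurable; rwa [hQ] at this
  have hGm : AEStronglyMeasurable (uncurry G) (volume.restrict (Ioo (-1 : ℝ) 0 ×ˢ ball (0 : E) 1)) := by
    have := hG.locallyIntegrableOn_grad.aestronglyMeasurable; rwa [hQ] at this
  have hv2Q : MemLp (uncurry v) 2 (volume.restrict (Ioo (-1 : ℝ) 0 ×ˢ ball (0 : E) 1)) :=
    memLp_of_slice_bound hIfin hvm two_ne_zero ENNReal.coe_lt_top (n := 2) (by exact_mod_cast h2)
  have hv4Q : MemLp (uncurry v) 4 (volume.restrict (Ioo (-1 : ℝ) 0 ×ˢ ball (0 : E) 1)) := by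
    refine memLp_of_lintegral_rpow_lt_top (by norm_num) (by norm_num) hvm ?_
    have : ((4 : ℝ≥0∞)).toReal = 4 := by norm_num
    rw [this]
    exact h4Q
  have hv3Q : MemLp (uncurry v) 3 (volume.restrict (Ioo (-1 : ℝ) 0 ×ˢ ball (0 : E) 1)) :=
    hv4Q.mono_exponent (by norm_num)
  have hpQ : MemLp (uncurry p) (3 / 2) (volume.restrict (Ioo (-1 : ℝ) 0 ×ˢ ball (0 : E) 1)) := by
    refine memLp_of_lintegral_rpow_lt_top three_halves_ne_zero three_halves_ne_top hpm ?_
    have : ((3 : ℝ≥0∞) / 2).toReal = 3 / 2 := by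
      rw [ENNReal.toReal_div]; norm_num
    rw [this]
    exact hp
  have hGQ : MemLp (uncurry G) 2 (volume.restrict (Ioo (-1 : ℝ) 0 ×ˢ ball (0 : E) 1)) :=
    memLp_two_of_frobeniusNormSq hGm hG2
  set ũ : ℝ × E → E := zeroExt Qo v with hũ
  set pt : ℝ × E → ℝ := zeroExt Qo p with hpt
  set Gt : ℝ × E → E →L[ℝ] E := zeroExt Qo G with hGt
  have hũ2 : MemLp ũ 2 volume := memLp_zeroExt hQ hQm hv2Q
  have hũ3 : MemLp ũ 3 volume := memLp_zeroExt hQ hQm hv3Q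
  have hpt32 : MemLp pt (3 / 2) volume := memLp_zeroExt hQ hQm hpQ
  have hGt2 : MemLp Gt 2 volume := memLp_zeroExt hQ hQm hGQ
  -- the weights
  have sφ : IsSmoothSpaceTimeOn univ φ := hφ.isSmoothSpaceTimeOn univ
  have cφ : Continuous (uncurry φ) := hφ.contDiff.continuous
  have cgφ : Continuous (uncurry fun s y => gradient (φ s) y) :=
    (sφ.gradient uniqueDiffOn_univ).continuous_uncurry
  have cΔφ : Continuous (uncurry fun s y => (Δ (φ s)) y) :=
    (sφ.laplacian uniqueDiffOn_univ).continuous_uncurry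
  have cTφ : Continuous (uncurry (timeDeriv φ)) := hφ.continuous_timeDeriv
  set wΔ : ℝ × E → ℝ := fun z => ν * (Δ (φ z.1)) z.2 + timeDeriv φ z.1 z.2 with hwΔ
  set wφ : ℝ × E → ℝ := fun z => φ z.1 z.2 with hwφ
  set wg : ℝ × E → E →L[ℝ] ℝ := fun z => innerSL ℝ (gradient (φ z.1) z.2) with hwg
  have cwΔ : Continuous wΔ := (continuous_const.mul cΔφ).add cTφ
  have cwg : Continuous wg := (innerSL ℝ).continuous.comp cgφ
  have hsuppφ : HasCompactSupport (uncurry φ) := hφ.hasCompactSupport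
  have hw0' : ∀ z, z ∉ tsupport (uncurry φ) → wφ z = 0 ∧ wg z = 0 ∧ wΔ z = 0 := fun z hz => by
    obtain ⟨h1, h2, h3, h4⟩ := weights_eq_zero_of_notMem_tsupport hz
    refine ⟨h1, ?_, ?_⟩
    · simp only [hwg, h2, map_zero]
    · simp only [hwΔ, h3, h4, mul_zero, add_zero]
  obtain ⟨CΔ, hCΔ⟩ := cwΔ.bounded_above_of_compact_support
    (hsuppφ.mono' fun z hz => by by_contra h; exact hz (hw0' z h).2.2)
  obtain ⟨Cφ, hCφ⟩ := cφ.bounded_above_of_compact_support hsuppφ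
  obtain ⟨Cg, hCg⟩ := cwg.bounded_above_of_compact_support
    (hsuppφ.mono' fun z hz => by by_contra h; exact hz (hw0' z h).2.1)
  have mwΔ : AEStronglyMeasurable wΔ volume := cwΔ.aestronglyMeasurable
  have mwφ : AEStronglyMeasurable wφ volume := cφ.aestronglyMeasurable
  have mwg : AEStronglyMeasurable wg volume := cwg.aestronglyMeasurable
  have bwΔ : ∀ᵐ z ∂(volume : Measure (ℝ × E)), ‖wΔ z‖ ≤ CΔ := Eventually.of_forall hCΔ
  have bwφ : ∀ᵐ z ∂(volume : Measure (ℝ × E)), ‖wφ z‖ ≤ Cφ := Eventually.of_forall hCφ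
  have bwg : ∀ᵐ z ∂(volume : Measure (ℝ × E)), ‖wg z‖ ≤ Cg := Eventually.of_forall hCg
  -- bilinear forms and Hölder triples
  set βI : E →L[ℝ] E →L[ℝ] ℝ := innerSL ℝ with hβI
  set βF : Fin (finrank ℝ E) → (E →L[ℝ] E) →L[ℝ] (E →L[ℝ] E) →L[ℝ] ℝ := fun i =>
    (innerSL ℝ).bilinearComp (ContinuousLinearMap.apply ℝ E (b i))
      (ContinuousLinearMap.apply ℝ E (b i)) with hβF
  set βs : ℝ →L[ℝ] E →L[ℝ] E := ContinuousLinearMap.lsmul ℝ ℝ with hβs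
  have βF_apply : ∀ i (L L' : E →L[ℝ] E), βF i L L' = ⟪L (b i), L' (b i)⟫ := fun i L L' => by
    simp [hβF]
  have βI_apply : ∀ x y : E, βI x y = ⟪x, y⟫ := fun x y => rfl
  have βs_apply : ∀ (a : ℝ) (x : E), βs a x = a • x := fun a x => rfl
  have wg_apply : ∀ (z : ℝ × E) (x : E), wg z x = ⟪gradient (φ z.1) z.2, x⟫ := fun z x => rfl
  haveI hHT33 : ENNReal.HolderTriple 3 3 (3 / 2) := by
    have h := holderTriple_ofReal (a := 3) (b := 3) (c := 3 / 2) (by norm_num) (by norm_num)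
      (by norm_num) (by norm_num)
    rwa [ENNReal.ofReal_ofNat, ENNReal.ofReal_div_of_pos (by norm_num), ENNReal.ofReal_ofNat,
      ENNReal.ofReal_ofNat] at h
  haveI hHT31 : ENNReal.HolderTriple (3 / 2) 3 1 := by
    have h := holderTriple_ofReal (a := 3 / 2) (b := 3) (c := 1) (by norm_num) (by norm_num)
      (by norm_num) (by norm_num)
    rwa [ENNReal.ofReal_ofNat, ENNReal.ofReal_div_of_pos (by norm_num), ENNReal.ofReal_ofNat,
      ENNReal.ofReal_ofNat, ENNReal.ofReal_one] at h
  haveI hHT22 : ENNReal.HolderTriple 2 2 1 := ENNReal.HolderConjugate.instTwoTwo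
  -- integrable model integrands
  have msq0 : MemLp (fun z => βI (ũ z) (ũ z)) (3 / 2) volume :=
    memLp_bilin (p := 3) (q := 3) (r := 3 / 2) βI hũ3 hũ3
  have iA : Integrable (fun z => wΔ z * βI (ũ z) (ũ z)) (volume : Measure (ℝ × E)) :=
    integrable_mul_bilin_of_memLp (p := 2) (q := 2) βI hũ2 hũ2 mwΔ bwΔ
  have iB1 : Integrable (fun z => wg z (βs (βI (ũ z) (ũ z)) (ũ z))) (volume : Measure (ℝ × E)) :=
    integrable_clm_bilin_of_memLp (p := 3 / 2) (q := 3) βs msq0 hũ3 mwg bwg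
  have iB2 : Integrable (fun z => wg z (βs (pt z) (ũ z))) (volume : Measure (ℝ × E)) :=
    integrable_clm_bilin_of_memLp (p := 3 / 2) (q := 3) βs hpt32 hũ3 mwg bwg
  have iL2 : ∀ i, Integrable (fun z => wφ z * βF i (Gt z) (Gt z)) (volume : Measure (ℝ × E)) :=
    fun i => integrable_mul_bilin_of_memLp (p := 2) (q := 2) (βF i) hGt2 hGt2 mwφ bwφ
  -- `FR`, `FL` agree with the model integrands everywhere
  have honQ : ∀ z ∈ K, z ∈ (Qo : Set (ℝ × E)) := fun z hz => by rw [hQ]; exact hKQ hz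
  have hFReq : FR = fun z => wΔ z * βI (ũ z) (ũ z) + (wg z (βs (βI (ũ z) (ũ z)) (ũ z)) +
      2 * wg z (βs (pt z) (ũ z))) := by
    funext z
    by_cases hz : z ∈ K
    · have hũv : ũ z = v z.1 z.2 := zeroExt_of_mem _ (honQ z hz)
      have hptp : pt z = p z.1 z.2 := zeroExt_of_mem _ (honQ z hz)
      rw [hFR]
      simp only [wg_apply, βs_apply, βI_apply, hũv, hptp, real_inner_smul_right, real_inner_self_eq_norm_sq]
      simp only [hwΔ]
      rw [real_inner_comm (gradient (φ z.1) z.2) (v z.1 z.2)]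
      ring
    · obtain ⟨h1, h2, h3⟩ := hw0' z hz
      rw [hFR0 z hz, h2, h3]
      simp
  have hFLeq : FL = fun z => ∑ i, wφ z * βF i (Gt z) (Gt z) := by
    funext z
    by_cases hz : z ∈ K
    · have hGtG : Gt z = G z.1 z.2 := zeroExt_of_mem _ (honQ z hz)
      rw [hFL]
      simp only [hGtG, βF_apply, real_inner_self_eq_norm_sq, hwφ]
      rw [frobeniusNormSq_eq_sum b, Finset.mul_sum]
    · obtain ⟨h1, -, -⟩ := hw0' z hz
      rw [hFL0 z hz]
      simp [show wφ z = 0 from h1]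
  have iR : Integrable FR (volume : Measure (ℝ × E)) := by
    rw [hFReq]
    exact iA.add (iB1.add (iB2.const_mul 2))
  have iL : Integrable FL (volume : Measure (ℝ × E)) := by
    rw [hFLeq]
    exact integrable_finsetSum _ fun i _ => iL2 i
  -- ## Fubini and conclusion
  have fR : ∫ z, FR z = ∫ t, ∫ x, FR (t, x) := by
    rw [Measure.volume_eq_prod] at iR ⊢
    exact integral_prod FR iR
  have fL : ∫ z, FL z = ∫ t, ∫ x, FL (t, x) := by
    rw [Measure.volume_eq_prod] at iL ⊢
    exact integral_prod FL iL
  have eRHS : (∫ t, ∫ x, (‖v t x‖ ^ 2 * (ν * (Δ (φ t)) x + timeDeriv φ t x) +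
      ⟪v t x, gradient (φ t) x⟫ * (‖v t x‖ ^ 2 + 2 * p t x))) = ∫ t, ∫ x, FR (t, x) := by
    simp only [hFR]
  have eLHS : (∫ t, ∫ x, φ t x * frobeniusNormSq (G t x)) = ∫ t, ∫ x, FL (t, x) := by
    simp only [hFL]
  rw [eRHS, eLHS, ← fR, ← fL]
  exact hidS.symm


/-! ### The Lions gate on an arbitrary parabolic cylinder `Q_r(t₀, x₀)` (parabolic rescaling to the unit cylinder) -/

omit [MeasurableSpace E] [BorelSpace E] in
/-- `frobeniusNormSq (c • L) = c² · frobeniusNormSq L`. [folklore] -/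
private theorem frobeniusNormSq_smul_aux (c : ℝ) (L : E →L[ℝ] E) :
    frobeniusNormSq (c • L) = c ^ 2 * frobeniusNormSq L := by
  unfold frobeniusNormSq
  rw [Finset.mul_sum]
  refine Finset.sum_congr rfl fun i _ => ?_
  rw [show (c • L) ((stdOrthonormalBasis ℝ E) i) = c • L ((stdOrthonormalBasis ℝ E) i) from rfl, norm_smul, mul_pow,
    Real.norm_eq_abs, sq_abs]

/-- **THE LIONS GATE ON AN ARBITRARY PARABOLIC CYLINDER.**  Let `(v, p)` be a distributional Navier–Stokes pair (any viscosity
`ν`, no force) on `Q_r(t₀, x₀) = (t₀ − r², t₀) × B(x₀, r)` (any dimension) with `v ∈ L_{2,∞}(Q_r)` (sliced bound), a weak spatial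
gradient `G ∈ L²(Q_r)`, `p ∈ L^{3/2}(Q_r)` and `v ∈ L⁴(Q_r)`.  Then every test function `φ ∈ C_c^∞(Q_r(t₀,x₀))` satisfies the
local energy identity WITH EQUALITY:
`∫ dt ∫ dx (|v|²(νΔφ + ∂ₜφ) + ⟪v, ∇φ⟫(|v|² + 2p)) = 2ν ∫ dt ∫ dx φ |G|²_F`.
Proof: the parabolic rescaling `ṽ(s,y) = r v(t₀ + r²s, x₀ + ry)`, `p̃ = r² p∘Φ`, `G̃ = r² G∘Φ` (tree `FluidPDE/SpaceTimeRescaling`) keeps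
`ν`, maps `Q_r(t₀,x₀)` to `Q₁(0,0)` and the data classes to themselves; `integral_integral_localEnergy_eq_of_L4` applies to the pulled-back
test `φ∘Φ`, and both sides of the identity scale by the same factor `r⁴ (r² rⁿ)⁻¹`. [cite: EscauriazaSereginSverak2003, §3, proof of Thm. 1.4 (scaling (3.5))] -/
theorem integral_integral_localEnergy_eq_of_L4_cylinder [Nontrivial E] {ν r t₀ : ℝ} {x₀ : E} (hr : 0 < r)
    {v : ℝ → E → E} {p : ℝ → E → ℝ} {G : ℝ → E → E →L[ℝ] E}
    (hNS : IsDistributionalNSSolutionOn (parabolicCylinderOpens r (t₀, x₀)) ν 0 v p)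
    (h2 : ∃ C : ℝ≥0, ∀ᵐ t ∂(volume.restrict (Ioo (t₀ - r ^ 2) t₀)),
      ∫⁻ x in ball x₀ r, ‖v t x‖ₑ ^ 2 ≤ C)
    (hG : HasWeakSpatialGradientOn (parabolicCylinderOpens r (t₀, x₀)) v G)
    (hG2 : ∫⁻ z in parabolicCylinder r (t₀, x₀), ENNReal.ofReal (frobeniusNormSq (G z.1 z.2)) < ∞)
    (hp : ∫⁻ z in parabolicCylinder r (t₀, x₀), ‖p z.1 z.2‖ₑ ^ (3 / 2 : ℝ) < ∞)
    (h4Q : ∫⁻ z in parabolicCylinder r (t₀, x₀), ‖v z.1 z.2‖ₑ ^ (4 : ℝ) < ∞)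
    {φ : ℝ → E → ℝ} (hφ : IsSpaceTimeTestOn (parabolicCylinderOpens r (t₀, x₀)) φ) :
    ∫ t, ∫ x, (‖v t x‖ ^ 2 * (ν * (Δ (φ t)) x + timeDeriv φ t x) +
        ⟪v t x, gradient (φ t) x⟫ * (‖v t x‖ ^ 2 + 2 * p t x)) =
      2 * ν * ∫ t, ∫ x, φ t x * frobeniusNormSq (G t x) := by
  -- ### the rescaling data
  set β : ℝ := r ^ 2 with hβdef
  have hβ : 0 < β := by positivity
  have hβeq : β = r * r := by rw [hβdef]; ring
  have hQr : parabolicCylinder r ((t₀ : ℝ), x₀) = Ioo (t₀ - r ^ 2) t₀ ×ˢ ball x₀ r := rfl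
  have hQ1 : parabolicCylinder 1 ((0 : ℝ), (0 : E)) = Ioo (-1 : ℝ) 0 ×ˢ ball (0 : E) 1 := parabolicCylinder_one_zero
  have hpre : stAffine β r t₀ x₀ ⁻¹' (Ioo (t₀ - r ^ 2) t₀ ×ˢ ball x₀ r) = Ioo (-1 : ℝ) 0 ×ˢ ball (0 : E) 1 := by
    rw [stAffine_preimage_cylinder hβ hr]
    have e1 : (t₀ - r ^ 2 - t₀) / β = (-1 : ℝ) := by
      rw [hβdef, show t₀ - r ^ 2 - t₀ = -(r ^ 2) by ring, neg_div, div_self (by positivity)]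
    have e2 : (t₀ - t₀) / β = (0 : ℝ) := by simp
    have e3 : r⁻¹ • (x₀ - x₀) = (0 : E) := by simp
    have e4 : r / r = (1 : ℝ) := div_self hr.ne'
    rw [e1, e2, e3, e4]
  have hOpens : stPreimage β r t₀ x₀ (parabolicCylinderOpens r ((t₀ : ℝ), x₀)) = parabolicCylinderOpens 1 ((0 : ℝ), (0 : E)) := by
    apply TopologicalSpace.Opens.ext
    rw [coe_stPreimage, coe_parabolicCylinderOpens, coe_parabolicCylinderOpens, hQr, hpre, hQ1]
  set w : ℝ → E → E := r • stPull β r t₀ x₀ v with hwdef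
  set q : ℝ → E → ℝ := r ^ 2 • stPull β r t₀ x₀ p with hqdef
  set G' : ℝ → E → E →L[ℝ] E := (r * r) • stPull β r t₀ x₀ G with hG'def
  set ψ : ℝ → E → ℝ := stPull β r t₀ x₀ φ with hψdef
  -- (a) the rescaled pair on the unit cylinder (same viscosity)
  have hNS₁ : IsDistributionalNSSolutionOn (parabolicCylinderOpens 1 ((0 : ℝ), (0 : E))) ν 0 w q := by
    have h := hNS.stRescale hr hr hβeq t₀ x₀
    have h0 : ((r ^ 2 * r) • stPull β r t₀ x₀ (0 : ℝ → E → E)) = 0 := by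
      funext s y
      rw [smul_stPull_apply]
      simp
    rw [hOpens, h0, show r * ν / r = ν by field_simp] at h
    exact h
  have hG₁ : HasWeakSpatialGradientOn (parabolicCylinderOpens 1 ((0 : ℝ), (0 : E))) w G' := by
    have h := hG.stRescale r hβ hr t₀ x₀
    rw [hOpens] at h
    exact h
  -- (b) sliced `L²` bound
  have h2₁ : ∃ C : ℝ≥0, ∀ᵐ t ∂(volume.restrict (Ioo (-1 : ℝ) 0)), ∫⁻ x in ball (0 : E) 1, ‖w t x‖ₑ ^ 2 ≤ C := by
    obtain ⟨C, hC⟩ := h2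
    have hC' : ∀ᵐ t ∂(volume.restrict (Ioo (t₀ + β * (-1)) (t₀ + β * 0))),
        ∫⁻ x in ball x₀ r, (fun t x => ‖v t x‖ₑ ^ 2) t x ≤ (C : ℝ≥0∞) := by
      have e : Ioo (t₀ + β * (-1)) (t₀ + β * 0) = Ioo (t₀ - r ^ 2) t₀ := by rw [hβdef]; ring_nf
      rw [e]; exact hC
    have h := ae_sliced_setLIntegral_ball_stRescale hβ hr t₀ x₀ x₀ r (-1) 0 (fun t x => ‖v t x‖ₑ ^ 2) hC'
    set B : ℝ≥0∞ := ENNReal.ofReal (r ^ 2) * (ENNReal.ofReal (r ^ Module.finrank ℝ E)⁻¹ * (C : ℝ≥0∞)) with hBdef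
    have hBtop : B < ⊤ :=
      ENNReal.mul_lt_top ENNReal.ofReal_lt_top (ENNReal.mul_lt_top ENNReal.ofReal_lt_top ENNReal.coe_lt_top)
    refine ⟨B.toNNReal, ?_⟩
    rw [ENNReal.coe_toNNReal hBtop.ne]
    filter_upwards [h] with s hs
    have e1 : ball (r⁻¹ • (x₀ - x₀)) (r / r) = ball (0 : E) 1 := by rw [sub_self, smul_zero, div_self hr.ne']
    rw [e1] at hs
    have e2 : ∀ y, ‖w s y‖ₑ ^ 2 = ENNReal.ofReal (r ^ 2) * ‖v (t₀ + β * s) (x₀ + r • y)‖ₑ ^ 2 := fun y => by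
      rw [hwdef, smul_stPull_apply, enorm_smul, mul_pow, ← ofReal_norm, Real.norm_of_nonneg hr.le,
        ENNReal.ofReal_pow hr.le]
    simp_rw [e2]
    rw [lintegral_const_mul' _ _ ENNReal.ofReal_ne_top, hBdef]
    exact mul_le_mul' le_rfl hs
  -- (c) the three finiteness statements on `Q₁`
  have hG2₁ : ∫⁻ z in parabolicCylinder 1 ((0 : ℝ), (0 : E)), ENNReal.ofReal (frobeniusNormSq (G' z.1 z.2)) < ∞ := by
    have h := setLIntegral_frobeniusNormSq_stRescale hβ hr t₀ x₀ (r * r) G (Ioo (t₀ - r ^ 2) t₀ ×ˢ ball x₀ r)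
    rw [hpre, ← hG'def] at h
    rw [hQ1, h]
    rw [hQr] at hG2
    exact ENNReal.mul_lt_top (ENNReal.mul_lt_top ENNReal.ofReal_lt_top ENNReal.ofReal_lt_top) hG2
  have hp₁ : ∫⁻ z in parabolicCylinder 1 ((0 : ℝ), (0 : E)), ‖q z.1 z.2‖ₑ ^ (3 / 2 : ℝ) < ∞ := by
    have h := setLIntegral_enorm_rpow_stRescale hβ hr t₀ x₀ (r ^ 2) p (Ioo (t₀ - r ^ 2) t₀ ×ˢ ball x₀ r)
      (r := 3 / 2) (by norm_num)
    rw [hpre, ← hqdef] at h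
    rw [hQ1, h]
    rw [hQr] at hp
    refine ENNReal.mul_lt_top (ENNReal.mul_lt_top ?_ ENNReal.ofReal_lt_top) hp
    exact ENNReal.rpow_lt_top_of_nonneg (by norm_num) enorm_ne_top
  have h4Q₁ : ∫⁻ z in parabolicCylinder 1 ((0 : ℝ), (0 : E)), ‖w z.1 z.2‖ₑ ^ (4 : ℝ) < ∞ := by
    have h := setLIntegral_enorm_rpow_stRescale hβ hr t₀ x₀ r v (Ioo (t₀ - r ^ 2) t₀ ×ˢ ball x₀ r)
      (r := 4) (by norm_num)
    rw [hpre, ← hwdef] at h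
    rw [hQ1, h]
    rw [hQr] at h4Q
    refine ENNReal.mul_lt_top (ENNReal.mul_lt_top ?_ ENNReal.ofReal_lt_top) h4Q
    exact ENNReal.rpow_lt_top_of_nonneg (by norm_num) enorm_ne_top
  -- (d) the pulled-back test and the unit-cylinder identity
  have hψ : IsSpaceTimeTestOn (parabolicCylinderOpens 1 ((0 : ℝ), (0 : E))) ψ := by
    have h := hφ.stPull hβ.ne' hr.ne' t₀ x₀
    rw [hOpens] at h
    exact h
  have hid := integral_integral_localEnergy_eq_of_L4 hNS₁ h2₁ hG₁ hG2₁ hp₁ h4Q₁ hψ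
  -- ### (e) pull back both sides: every integrand scales by `r⁴`
  set FL : ℝ → E → ℝ := fun t x => ‖v t x‖ ^ 2 * (ν * (Δ (φ t)) x + timeDeriv φ t x) +
    ⟪v t x, gradient (φ t) x⟫ * (‖v t x‖ ^ 2 + 2 * p t x) with hFL
  set FR : ℝ → E → ℝ := fun t x => φ t x * frobeniusNormSq (G t x) with hFR
  have hφ2 : ∀ t, ContDiff ℝ 2 (φ t) := fun t => (hφ.contDiff.comp (contDiff_prodMk_right t)).of_le (by norm_cast)
  have hptL : ∀ s y, ‖w s y‖ ^ 2 * (ν * (Δ (ψ s)) y + timeDeriv ψ s y) +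
      ⟪w s y, gradient (ψ s) y⟫ * (‖w s y‖ ^ 2 + 2 * q s y) = r ^ 4 * FL (t₀ + β * s) (x₀ + r • y) := by
    intro s y
    have ev : w s y = r • v (t₀ + β * s) (x₀ + r • y) := by rw [hwdef, smul_stPull_apply]
    have eq' : q s y = r ^ 2 * p (t₀ + β * s) (x₀ + r • y) := by rw [hqdef, smul_stPull_apply, smul_eq_mul]
    have eT : timeDeriv ψ s y = β * timeDeriv φ (t₀ + β * s) (x₀ + r • y) := by
      rw [hψdef, timeDeriv_stPull, smul_eq_mul]
    have eg : gradient (ψ s) y = r • gradient (φ (t₀ + β * s)) (x₀ + r • y) := by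
      rw [hψdef]; exact gradient_stPull β r t₀ x₀ φ s y
    have eΔ : (Δ (ψ s)) y = r ^ 2 * (Δ (φ (t₀ + β * s))) (x₀ + r • y) := by
      rw [hψdef, laplacian_stPull β r t₀ x₀ φ s y (hφ2 _), smul_eq_mul]
    rw [ev, eq', eT, eg, eΔ, hFL, norm_smul, Real.norm_of_nonneg hr.le, real_inner_smul_left, real_inner_smul_right,
      hβdef]
    ring
  have hptR : ∀ s y, ψ s y * frobeniusNormSq (G' s y) = r ^ 4 * FR (t₀ + β * s) (x₀ + r • y) := by
    intro s y
    have eψ : ψ s y = φ (t₀ + β * s) (x₀ + r • y) := by rw [hψdef, stPull_apply]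
    have eG : G' s y = (r * r) • G (t₀ + β * s) (x₀ + r • y) := by
      rw [hG'def]
      simp only [Pi.smul_apply, stPull_apply]
    rw [eψ, eG, frobeniusNormSq_smul_aux, hFR]
    ring
  have hcvL := integral_integral_comp_stAffine hβ hr t₀ x₀ FL
  have hcvR := integral_integral_comp_stAffine hβ hr t₀ x₀ FR
  have eL : (∫ s, ∫ y, ‖w s y‖ ^ 2 * (ν * (Δ (ψ s)) y + timeDeriv ψ s y) +
      ⟪w s y, gradient (ψ s) y⟫ * (‖w s y‖ ^ 2 + 2 * q s y)) =
      r ^ 4 * ((β * r ^ Module.finrank ℝ E)⁻¹ • ∫ t, ∫ x, FL t x) := by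
    have e1 : (fun s => ∫ y, ‖w s y‖ ^ 2 * (ν * (Δ (ψ s)) y + timeDeriv ψ s y) +
        ⟪w s y, gradient (ψ s) y⟫ * (‖w s y‖ ^ 2 + 2 * q s y)) =
        fun s => r ^ 4 * ∫ y, FL (t₀ + β * s) (x₀ + r • y) := by
      funext s
      rw [← integral_const_mul]
      exact integral_congr_ae (Eventually.of_forall (hptL s))
    rw [e1, integral_const_mul, hcvL]
  have eR : (∫ s, ∫ y, ψ s y * frobeniusNormSq (G' s y)) =
      r ^ 4 * ((β * r ^ Module.finrank ℝ E)⁻¹ • ∫ t, ∫ x, FR t x) := by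
    have e1 : (fun s => ∫ y, ψ s y * frobeniusNormSq (G' s y)) =
        fun s => r ^ 4 * ∫ y, FR (t₀ + β * s) (x₀ + r • y) := by
      funext s
      rw [← integral_const_mul]
      exact integral_congr_ae (Eventually.of_forall (hptR s))
    rw [e1, integral_const_mul, hcvR]
  rw [eL, eR, smul_eq_mul, smul_eq_mul] at hid
  have hk : (0 : ℝ) < r ^ 4 * (β * r ^ Module.finrank ℝ E)⁻¹ := by positivity
  have hid' : r ^ 4 * (β * r ^ Module.finrank ℝ E)⁻¹ * (∫ t, ∫ x, FL t x) =
      r ^ 4 * (β * r ^ Module.finrank ℝ E)⁻¹ * (2 * ν * ∫ t, ∫ x, FR t x) := by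
    rw [mul_assoc, hid]; ring
  have := mul_left_cancel₀ hk.ne' hid'
  simpa only [hFL, hFR] using this

end Main

end Literature.Analysis.FluidPDE

end
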